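import Mathlib.Geometry.Manifold.ContMDiff.Atlas
import Mathlib.Geometry.Manifold.ContMDiff.NormedSpace
import Mathlib.Geometry.Manifold.Diffeomorph
import Mathlib.Geometry.Euclidean.Inversion.Calculus
import Mathlib.Topology.Compactification.OnePoint.Sphere
import Mathlib.Analysis.InnerProductSpace.PiL2
import Literature.Topology.FourManifolds.SmoothPoincareTwoHolds
import Literature.Topology.FourManifolds.UnorientedDiscTheorem
import Literature.Topology.FourManifolds.SmoothEmbeddingCriteria
import Mathlib.Analysis.InnerProductSpace.Calculus
import Mathlib.Analysis.InnerProductSpace.Projection.FiniteDimensional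
import Mathlib.Geometry.Manifold.PoincareConjecture
import HarnessLib

/-!
# Smoothing a disc relative to its boundary (Hatcher's Handle Smoothing Theorem (2) / Fact 6), by one-point gluing

Topic `Literature/Topology/FourManifolds` (uniqueness half of spc4.S33,
`Literature.Topology.FourManifolds.nonempty_diffeomorph_of_homeomorph_of_le_three`, leaf `n = 2`:
"homeomorphic smooth surfaces are diffeomorphic").  A. Hatcher, *The Kirby torus trick for
surfaces* (arXiv:1312.3518, 2013; L'Enseignement Math. 72 (2025) 161–174) proves
"**Theorem B.** Every homeomorphism between smooth surfaces is isotopic to a diffeomorphism" from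
three handle smoothing theorems, the last of which is

> **(2)** An embedding `D² → S` which is a smooth embedding in a neighborhood of `∂D²` can be
> isotoped to be a smooth embedding on all of `D²`, staying fixed in a smaller neighborhood of
> `∂D²`,

itself deduced ("Smoothing 2-handles": pull the structure back, apply Fact 6, Alexander trick)
from

> **Fact 6.** Every smooth structure on `D²` that is standard near `∂D²` is diffeomorphic to the
> standard structure via a diffeomorphism that is the identity near `∂D²`.

Hatcher proves Fact 6 by Morse theory on the disc.  **This file proves the static form of (2) /
Fact 6 — in every dimension `n ≠ 0` in which the smooth Poincaré conjecture holds, and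
unconditionally for `n = 2`** — from two theorems of the tree, the smooth Poincaré conjecture in
dimension two (`Literature.Topology.FourManifolds.nonemptyDiffeomorphSphere_two_holds`,
`SmoothPoincareTwoHolds.lean`) and the disc theorem of Palais–Cerf without orientation hypotheses
(`Literature.Topology.FourManifolds.exists_diffeomorph_apply_disc_eq_or_reflect_cs`,
`UnorientedDiscTheorem.lean`), by a **one-point gluing** argument (a proof of Fact 6 different
from Hatcher's; everything below is proved, no named fact is introduced, no new vocabulary beyond
bookkeeping definitions with bodies).

## The argument

Let `F : ℝⁿ ⇀ M` be an open topological embedding of the ball `‖z‖ < r₂` into a smooth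
`n`-manifold `M` which is a `C^∞` diffeomorphism onto its image on the shell `r₁ < ‖z‖ < r₂`
(*glue data* `d`), and `r₁ < R ≤ r₂`.  On the one-point compactification `OnePoint ℝⁿ` the charts

* `chartAt (F z) ∘ F ∘ coe⁻¹` on `coe '' ball 0 r₂` ("south": the structure of `M` pulled back
  along `F`), and
* the inversion `z ↦ z / ‖z‖²`, `∞ ↦ 0`, on `{‖z‖ > r₁} ∪ {∞}` ("north": the standard structure
  near infinity)

are pairwise `C^∞`-compatible (on the overlap — the shell — `F` is a diffeomorphism), so they
form a `C^∞` atlas: the **glued sphere** `Q = Glued d`, a compact Hausdorff second-countable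
`C^∞` manifold homeomorphic to `Sⁿ` (Part 1).  For `F = id` this is the standard conformal sphere
`P = Glued d.std = ℝⁿ ∪ {∞}`.  By the smooth Poincaré hypothesis both are diffeomorphic to `𝕊ⁿ`,
so there is a diffeomorphism `Θ₀ : Q → P`.  The caps `{‖z‖ ≥ R} ∪ {∞}` of `Q` and of `P` are
smooth closed discs with the SAME parametrisation `j = (north chart)⁻¹ ∘ squeeze` by the closed
unit ball; the disc theorem in the connected manifold `P` moves the disc `Θ₀ ∘ j_Q` to `j_P` or to
`j_P ∘ r` (`r` a reflection) by a diffeomorphism `τ` of `P`.  Then `Θ = τ ∘ Θ₀ : Q → P` satisfies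
`Θ z = A z` for `‖z‖ ≥ R` (`A ∈ {1, r⁻¹}` a linear isometry) and `Θ ∞ = ∞` (Part 2), and the planar
map `g z = Θ⁻¹ (A z)` is a homeomorphism of `ℝⁿ`, the identity on `‖z‖ ≥ R`, with
`F ∘ g = (F ∘ coe⁻¹)|_Q ∘ Θ⁻¹ ∘ (coe ∘ A)|_P` a composite of smooth maps, i.e. `F ∘ g` is a
diffeomorphism of the whole ball onto `F (ball)` agreeing with `F` on the outer shell (Part 3).

## Contents (namespace `Literature.Topology.FourManifolds.OnePointGluing`)

Part 1 — one-point gluing: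
* `sInv` — inversion in the unit sphere of `ℝⁿ` (`EuclideanGeometry.inversion 0 1`) and its API;
  `northChart r hr` — the chart at infinity of `OnePoint ℝⁿ` (source `{‖z‖ > r} ∪ {∞}`, target
  `ball 0 r⁻¹`); `coeH` — the inclusion `ℝⁿ → OnePoint ℝⁿ` as an open partial homeomorphism;
* `GlueData n M`, `Glued d` with its `ChartedSpace (EuclideanSpace ℝ (Fin n))` structure
  (`Glued.southChart`, `Glued.northChart'`), `Glued.instIsManifold : IsManifold (𝓡 n) ∞ (Glued d)`,
  topological instances and `Glued.homeomorphSphere : Glued d ≃ₜ 𝕊ⁿ`;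
* smoothness of the structure maps: `Glued.contMDiffOn_F_comp_coeH_symm` (`F ∘ coe⁻¹` on
  `coe '' ball 0 r₂`), `Glued.contMDiffOn_pt_comp_F_symm` (`coe ∘ F⁻¹` on `F '' ball 0 r₂`),
  `Glued.contMDiffOn_pt`, `Glued.contMDiffOn_coeH_symm` (near infinity).

Part 2 — caps and the normalised diffeomorphism:
* `GlueData.std` (the standard data `F = id`), `Glued.contMDiff_pt_std`,
  `Glued.contMDiffOn_coeH_symm_std`; `squeeze` — the radial diffeomorphism
  `y ↦ ρ λ (1 + λ²‖y‖²)^{-1/2} y` of `ℝⁿ` onto `ball 0 ρ` and its norm control; `capEmb` — the cap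
  parametrisation `j` and `isSmoothEmbedding_capEmb`; `exists_diffeomorph_glued_eq_on_cap` — `Θ`.

Part 3 — the theorem:
* **`exists_homeomorph_smoothing_rel_shell`** — in dimension `n ≠ 0` under the smooth Poincaré
  hypothesis in dimension `n`: a homeomorphism `g` of `ℝⁿ` with `g z = z` for `‖z‖ ≥ R`, `F ∘ g`
  smooth on `ball 0 r₂` and `g⁻¹ ∘ F⁻¹` smooth on `F '' ball 0 r₂`;
* **`exists_homeomorph_smoothing_disc_rel_shell_two`** — the unconditional statement for surfaces.

What is NOT here: the isotopy clause of Hatcher's (2) (the Alexander trick), not needed for the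
uniqueness of smooth structures up to diffeomorphism; Handle Smoothing (0) (in the tree:
`PlanarSmoothStructures.lean`) and (1).

## References

* A. Hatcher, *The Kirby torus trick for surfaces*, arXiv:1312.3518 (2013); L'Enseignement
  Math. 72 (2025) 161–174: Handle Smoothing Theorem (2), "Smoothing 2-handles", Fact 6.
  [Hatcher2025]
* R. Palais, *Extending diffeomorphisms*, Proc. AMS 11 (1960), Thm. B (the disc theorem).
  [Palais1960]
* J. Milnor, *Topology from the Differentiable Viewpoint* (1965), §1 (the smooth structure of
  `Sⁿ` by two charts). [MilnorTDV1965]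
-/

noncomputable section

open Set Function Metric Filter
open scoped Manifold ContDiff Topology

namespace Literature.Topology.FourManifolds

/-- Local notation: `𝔼 n` is the model Euclidean space `EuclideanSpace ℝ (Fin n)`. -/
local notation "𝔼 " n:arg => EuclideanSpace ℝ (Fin n)

namespace OnePointGluing

variable {n : ℕ}

/-! ## Part 1: one-point gluing -/

/-! ### Inversion in the unit sphere of `ℝⁿ` -/

/-- Inversion of `ℝⁿ` in the unit sphere about the origin, `z ↦ z / ‖z‖²` (`0 ↦ 0`):
Mathlib's `EuclideanGeometry.inversion 0 1`. [folklore] -/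
def sInv (z : 𝔼 n) : 𝔼 n := EuclideanGeometry.inversion (0 : 𝔼 n) 1 z

/-- The formula `sInv z = ‖z‖⁻² • z`. [folklore] -/
theorem sInv_apply (z : 𝔼 n) : sInv z = (‖z‖ ^ 2)⁻¹ • z := by
  simp only [sInv, EuclideanGeometry.inversion, dist_zero_right, vsub_eq_sub, sub_zero,
    vadd_eq_add, add_zero, one_div, inv_pow]

/-- `‖sInv z‖ = ‖z‖⁻¹` (also for `z = 0`, both sides being `0`). [folklore] -/
theorem norm_sInv (z : 𝔼 n) : ‖sInv z‖ = ‖z‖⁻¹ := by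
  have h := EuclideanGeometry.dist_inversion_center (0 : 𝔼 n) z 1
  rw [dist_zero_right, dist_zero_right, one_pow, one_div] at h
  exact h

/-- `sInv 0 = 0`. [folklore] -/
@[simp] theorem sInv_zero : sInv (0 : 𝔼 n) = 0 := EuclideanGeometry.inversion_self _ _

/-- Inversion is an involution. [folklore] -/
theorem sInv_sInv (z : 𝔼 n) : sInv (sInv z) = z :=
  EuclideanGeometry.inversion_inversion _ one_ne_zero _

/-- `sInv z = 0 ↔ z = 0`. [folklore] -/
theorem sInv_eq_zero_iff {z : 𝔼 n} : sInv z = 0 ↔ z = 0 :=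
  EuclideanGeometry.inversion_eq_center one_ne_zero

/-- `sInv z ≠ 0` for `z ≠ 0`. [folklore] -/
theorem sInv_ne_zero {z : 𝔼 n} (hz : z ≠ 0) : sInv z ≠ 0 := fun h => hz (sInv_eq_zero_iff.1 h)

/-- Inversion is injective. [folklore] -/
theorem sInv_injective : Injective (sInv : 𝔼 n → 𝔼 n) :=
  EuclideanGeometry.inversion_injective _ one_ne_zero

/-- Inversion is `C^∞` away from the origin. [folklore] -/
theorem contDiffAt_sInv {z : 𝔼 n} (hz : z ≠ 0) : ContDiffAt ℝ ∞ (sInv : 𝔼 n → 𝔼 n) z := by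
  have h : ContDiffAt ℝ ((⊤ : ℕ∞) : ℕ∞ω)
      (fun a : 𝔼 n => EuclideanGeometry.inversion ((fun _ => (0 : 𝔼 n)) a) ((fun _ => (1 : ℝ)) a)
        (id a)) z :=
    ContDiffAt.inversion contDiffAt_const contDiffAt_const contDiffAt_id hz
  exact h

/-- Inversion is `C^∞` on `{z ≠ 0}`. [folklore] -/
theorem contDiffOn_sInv : ContDiffOn ℝ ∞ (sInv : 𝔼 n → 𝔼 n) {z | z ≠ 0} := fun _ hz =>
  (contDiffAt_sInv hz).contDiffWithinAt

/-- Inversion is continuous away from the origin. [folklore] -/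
theorem continuousAt_sInv {z : 𝔼 n} (hz : z ≠ 0) : ContinuousAt (sInv : 𝔼 n → 𝔼 n) z :=
  (contDiffAt_sInv hz).continuousAt

/-- Inversion commutes with linear isometries. [folklore] -/
theorem sInv_map (A : 𝔼 n ≃ₗᵢ[ℝ] 𝔼 n) (z : 𝔼 n) : sInv (A z) = A (sInv z) := by
  rw [sInv_apply, sInv_apply, A.norm_map, A.map_smul]

/-- Inversion tends to `0` along the cocompact filter. [folklore] -/
theorem tendsto_sInv_cocompact :
    Tendsto (sInv : 𝔼 n → 𝔼 n) (coclosedCompact (𝔼 n)) (𝓝 0) := by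
  rw [Metric.tendsto_nhds]
  intro ε hε
  rw [Filter.hasBasis_coclosedCompact.eventually_iff]
  refine ⟨closedBall 0 ε⁻¹, ⟨isClosed_closedBall, isCompact_closedBall _ _⟩, fun z hz => ?_⟩
  simp only [mem_compl_iff, mem_closedBall, dist_zero_right, not_le] at hz
  rw [dist_zero_right, norm_sInv]
  have hz0 : 0 < ‖z‖ := lt_trans (inv_pos.2 hε) hz
  calc ‖z‖⁻¹ < (ε⁻¹)⁻¹ := (inv_lt_inv₀ hz0 (inv_pos.2 hε)).2 hz
    _ = ε := inv_inv ε

/-! ### The chart at infinity of `OnePoint ℝⁿ` -/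

/-- The chart at infinity as a function: `∞ ↦ 0`, `z ↦ z / ‖z‖²`. [folklore] -/
def northFun : OnePoint (𝔼 n) → 𝔼 n := fun p => p.elim 0 sInv

/-- Its inverse: `0 ↦ ∞`, `w ↦ w / ‖w‖²`. [folklore] -/
def northInv : 𝔼 n → OnePoint (𝔼 n) := fun w =>
  if w = 0 then OnePoint.infty else ((sInv w : 𝔼 n) : OnePoint (𝔼 n))

/-- `northFun ∞ = 0`. [folklore] -/
@[simp] theorem northFun_infty : northFun (OnePoint.infty : OnePoint (𝔼 n)) = 0 := rfl

/-- `northFun z = sInv z` at finite points. [folklore] -/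
@[simp] theorem northFun_coe (z : 𝔼 n) : northFun (z : OnePoint (𝔼 n)) = sInv z := rfl

/-- `northInv 0 = ∞`. [folklore] -/
@[simp] theorem northInv_zero : northInv (0 : 𝔼 n) = OnePoint.infty := by simp [northInv]

/-- `northInv w = sInv w` for `w ≠ 0`. [folklore] -/
theorem northInv_of_ne_zero {w : 𝔼 n} (hw : w ≠ 0) :
    northInv w = ((sInv w : 𝔼 n) : OnePoint (𝔼 n)) := by
  simp [northInv, hw]

/-- Membership in the complement of the image of a closed ball. [folklore] -/
theorem coe_mem_compl_image_closedBall {r : ℝ} {z : 𝔼 n} :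
    (z : OnePoint (𝔼 n)) ∈ (((↑) : 𝔼 n → OnePoint (𝔼 n)) '' closedBall 0 r)ᶜ ↔ r < ‖z‖ := by
  rw [mem_compl_iff, OnePoint.coe_injective.mem_set_image, mem_closedBall, dist_zero_right, not_le]

/-- `∞` lies in the complement of the image of any subset of `ℝⁿ`. [folklore] -/
theorem infty_mem_compl_image_closedBall {r : ℝ} :
    (OnePoint.infty : OnePoint (𝔼 n)) ∈ (((↑) : 𝔼 n → OnePoint (𝔼 n)) '' closedBall 0 r)ᶜ :=
  OnePoint.infty_notMem_image_coe

/-- **The chart at infinity** of `OnePoint ℝⁿ`: the inversion in the unit sphere, on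
`{‖z‖ > r} ∪ {∞}`, onto the open ball of radius `r⁻¹`. [cite: MilnorTDV1965, §1] -/
def northChart (r : ℝ) (hr : 0 < r) : OpenPartialHomeomorph (OnePoint (𝔼 n)) (𝔼 n) where
  toFun := northFun
  invFun := northInv
  source := (((↑) : 𝔼 n → OnePoint (𝔼 n)) '' closedBall 0 r)ᶜ
  target := ball 0 r⁻¹
  map_source' := by
    intro p hp
    induction p using OnePoint.rec with
    | infty => rw [northFun_infty, mem_ball, dist_self]; exact inv_pos.2 hr
    | coe z =>
      rw [coe_mem_compl_image_closedBall] at hp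
      have hz : 0 < ‖z‖ := hr.trans hp
      rw [northFun_coe, mem_ball, dist_zero_right, norm_sInv]
      exact (inv_lt_inv₀ hz hr).2 hp
  map_target' := by
    intro w hw
    rw [mem_ball, dist_zero_right] at hw
    by_cases h0 : w = 0
    · subst h0; rw [northInv_zero]; exact infty_mem_compl_image_closedBall
    · rw [northInv_of_ne_zero h0, coe_mem_compl_image_closedBall, norm_sInv]
      have hw0 : 0 < ‖w‖ := norm_pos_iff.2 h0
      rwa [lt_inv_comm₀ hr hw0]
  left_inv' := by
    intro p hp
    induction p using OnePoint.rec with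
    | infty => show northInv (northFun OnePoint.infty) = OnePoint.infty; rw [northFun_infty, northInv_zero]
    | coe z =>
      rw [coe_mem_compl_image_closedBall] at hp
      have hz : z ≠ 0 := norm_pos_iff.1 (hr.trans hp)
      show northInv (northFun (z : OnePoint (𝔼 n))) = z
      rw [northFun_coe, northInv_of_ne_zero (sInv_ne_zero hz), sInv_sInv]
  right_inv' := by
    intro w _
    by_cases h0 : w = 0
    · subst h0; show northFun (northInv 0) = 0; rw [northInv_zero, northFun_infty]
    · show northFun (northInv w) = w
      rw [northInv_of_ne_zero h0, northFun_coe, sInv_sInv]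
  open_source := by
    rw [isOpen_compl_iff]
    exact OnePoint.isClosed_image_coe.2 ⟨isClosed_closedBall, isCompact_closedBall _ _⟩
  open_target := isOpen_ball
  continuousOn_toFun := by
    intro p hp
    refine ContinuousAt.continuousWithinAt ?_
    induction p using OnePoint.rec with
    | infty =>
      rw [OnePoint.continuousAt_infty']
      exact tendsto_sInv_cocompact
    | coe z =>
      rw [coe_mem_compl_image_closedBall] at hp
      rw [OnePoint.continuousAt_coe]
      exact continuousAt_sInv (norm_pos_iff.1 (hr.trans hp))
  continuousOn_invFun := by
    intro w _
    refine ContinuousAt.continuousWithinAt ?_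
    by_cases h0 : w = 0
    · subst h0
      change Tendsto northInv (𝓝 0) (𝓝 (northInv 0))
      rw [northInv_zero, OnePoint.hasBasis_nhds_infty.tendsto_right_iff]
      rintro t ⟨-, ht⟩
      obtain ⟨ρ, hρ, htρ⟩ := ht.isBounded.subset_closedBall_lt 0 0
      filter_upwards [Metric.ball_mem_nhds (0 : 𝔼 n) (inv_pos.2 hρ)] with w hw
      by_cases hw0 : w = 0
      · subst hw0; simp
      · left
        refine ⟨sInv w, fun hmem => ?_, (northInv_of_ne_zero hw0).symm⟩
        have h1 := htρ hmem
        rw [mem_closedBall, dist_zero_right, norm_sInv] at h1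
        rw [mem_ball, dist_zero_right] at hw
        have hw' : 0 < ‖w‖ := norm_pos_iff.2 hw0
        have : ρ < ‖w‖⁻¹ := by rwa [lt_inv_comm₀ hρ hw']
        exact absurd h1 (not_le.2 this)
    · have heq : northInv =ᶠ[𝓝 w] fun w => ((sInv w : 𝔼 n) : OnePoint (𝔼 n)) := by
        filter_upwards [isOpen_ne.mem_nhds h0] with w' hw'
        exact northInv_of_ne_zero hw'
      refine ContinuousAt.congr_of_eventuallyEq ?_ heq
      exact OnePoint.continuous_coe.continuousAt.comp (continuousAt_sInv h0)

/-- The chart at infinity is `northFun`. [folklore] -/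
@[simp] theorem northChart_apply {r : ℝ} (hr : 0 < r) (p : OnePoint (𝔼 n)) :
    northChart r hr p = northFun p := rfl

/-- The inverse of the chart at infinity is `northInv`. [folklore] -/
@[simp] theorem northChart_symm_apply {r : ℝ} (hr : 0 < r) (w : 𝔼 n) :
    (northChart r hr).symm w = northInv w := rfl

/-- The source of the chart at infinity. [folklore] -/
theorem northChart_source {r : ℝ} (hr : 0 < r) :
    (northChart (n := n) r hr).source = (((↑) : 𝔼 n → OnePoint (𝔼 n)) '' closedBall 0 r)ᶜ := rfl

/-- The target of the chart at infinity is `ball 0 r⁻¹`. [folklore] -/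
theorem northChart_target {r : ℝ} (hr : 0 < r) :
    (northChart (n := n) r hr).target = ball 0 r⁻¹ := rfl

/-- A finite point lies in the source of the chart at infinity iff `r < ‖z‖`. [folklore] -/
theorem coe_mem_northChart_source {r : ℝ} (hr : 0 < r) {z : 𝔼 n} :
    (z : OnePoint (𝔼 n)) ∈ (northChart r hr).source ↔ r < ‖z‖ :=
  coe_mem_compl_image_closedBall

/-- `∞` lies in the source of the chart at infinity. [folklore] -/
theorem infty_mem_northChart_source {r : ℝ} (hr : 0 < r) :
    (OnePoint.infty : OnePoint (𝔼 n)) ∈ (northChart r hr).source :=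
  infty_mem_compl_image_closedBall

/-! ### The inclusion `ℝⁿ → OnePoint ℝⁿ` as an open partial homeomorphism -/

/-- The inclusion of `ℝⁿ` in its one-point compactification, as an open partial homeomorphism
(source `univ`, target the complement of `∞`). [folklore] -/
def coeH : OpenPartialHomeomorph (𝔼 n) (OnePoint (𝔼 n)) :=
  OnePoint.isOpenEmbedding_coe.toOpenPartialHomeomorph (↑)

/-- `coeH` is the inclusion. [folklore] -/
@[simp] theorem coeH_apply (z : 𝔼 n) : coeH z = (z : OnePoint (𝔼 n)) := rfl

/-- The source of `coeH` is everything. [folklore] -/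
@[simp] theorem coeH_source : (coeH (n := n)).source = univ := rfl

/-- The target of `coeH` is the set of finite points. [folklore] -/
theorem coeH_target : (coeH (n := n)).target = range ((↑) : 𝔼 n → OnePoint (𝔼 n)) := by
  rw [coeH, Topology.IsOpenEmbedding.toOpenPartialHomeomorph_target]

/-- `coeH.symm` is a left inverse of the inclusion. [folklore] -/
@[simp] theorem coeH_symm_coe (z : 𝔼 n) : (coeH (n := n)).symm z = z :=
  OnePoint.isOpenEmbedding_coe.toOpenPartialHomeomorph_left_inv

/-- `coeH.symm` is a right inverse of the inclusion away from `∞`. [folklore] -/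
theorem coe_coeH_symm {p : OnePoint (𝔼 n)} (hp : p ≠ OnePoint.infty) :
    (((coeH (n := n)).symm p : 𝔼 n) : OnePoint (𝔼 n)) = p := by
  obtain ⟨z, rfl⟩ := OnePoint.ne_infty_iff_exists.1 hp
  rw [coeH_symm_coe]

/-! ### Glue data and the glued sphere -/

variable {M : Type*} [TopologicalSpace M] [ChartedSpace (𝔼 n) M]

/-- **Glue data**: an open topological embedding `F` of (a neighbourhood of) the ball `‖z‖ < r₂`
of `ℝⁿ` into the `n`-manifold `M` which is a `C^∞` diffeomorphism onto its (open) image on the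
shell `r₁ < ‖z‖ < r₂` (`0 < r₁ < r₂`). [cite: Hatcher2025, Handle Smoothing Theorem (2)] -/
structure GlueData (n : ℕ) (M : Type*) [TopologicalSpace M] [ChartedSpace (𝔼 n) M] where
  /-- the embedding of the ball -/
  F : OpenPartialHomeomorph (𝔼 n) M
  /-- inner radius of the shell -/
  r₁ : ℝ
  /-- outer radius of the shell (radius of the ball) -/
  r₂ : ℝ
  r₁_pos : 0 < r₁
  r₁_lt_r₂ : r₁ < r₂
  ball_subset : ball (0 : 𝔼 n) r₂ ⊆ F.source
  contMDiffOn : ContMDiffOn 𝓘(ℝ, 𝔼 n) (𝓡 n) ∞ F {z : 𝔼 n | r₁ < ‖z‖ ∧ ‖z‖ < r₂}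
  contMDiffOn_symm :
    ContMDiffOn (𝓡 n) 𝓘(ℝ, 𝔼 n) ∞ F.symm (F '' {z : 𝔼 n | r₁ < ‖z‖ ∧ ‖z‖ < r₂})

namespace GlueData

variable (d : GlueData n M)

/-- `0 < r₂`. [folklore] -/
theorem r₂_pos : 0 < d.r₂ := d.r₁_pos.trans d.r₁_lt_r₂

/-- The shell `r₁ < ‖z‖ < r₂`. [folklore] -/
def shell : Set (𝔼 n) := {z : 𝔼 n | d.r₁ < ‖z‖ ∧ ‖z‖ < d.r₂}

/-- Membership in the shell. [folklore] -/
theorem mem_shell {z : 𝔼 n} : z ∈ d.shell ↔ d.r₁ < ‖z‖ ∧ ‖z‖ < d.r₂ := Iff.rfl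

/-- The shell is open. [folklore] -/
theorem isOpen_shell : IsOpen d.shell :=
  (isOpen_lt continuous_const continuous_norm).inter (isOpen_lt continuous_norm continuous_const)

/-- The shell lies in the ball of radius `r₂`. [folklore] -/
theorem shell_subset_ball : d.shell ⊆ ball 0 d.r₂ := fun z hz => by
  rw [mem_ball, dist_zero_right]; exact hz.2

/-- The shell lies in the source of `F`. [folklore] -/
theorem shell_subset_source : d.shell ⊆ d.F.source := fun _ hz => d.ball_subset (d.shell_subset_ball hz)

/-- `F` restricted to the open ball of radius `r₂`. [folklore] -/
def Fb : OpenPartialHomeomorph (𝔼 n) M := d.F.restrOpen (ball 0 d.r₂) isOpen_ball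

/-- `Fb = F` as functions. [folklore] -/
@[simp] theorem Fb_apply (z : 𝔼 n) : d.Fb z = d.F z := rfl

/-- `Fb.symm = F.symm` as functions. [folklore] -/
@[simp] theorem Fb_symm_apply (m : M) : d.Fb.symm m = d.F.symm m := rfl

/-- The source of `Fb` is the ball of radius `r₂`. [folklore] -/
theorem Fb_source : d.Fb.source = ball 0 d.r₂ := by
  rw [Fb, OpenPartialHomeomorph.restrOpen_source, inter_eq_right]
  exact d.ball_subset

/-- The target of `Fb` is `F '' ball 0 r₂`. [folklore] -/
theorem Fb_target : d.Fb.target = d.F '' ball 0 d.r₂ := by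
  rw [← d.Fb.image_source_eq_target, Fb_source]; rfl

end GlueData

/-- **The glued sphere** of the glue data `d`: the one-point compactification `OnePoint ℝⁿ`, to be
equipped with the structure of `M` (pulled back along `d.F`) on the ball `‖z‖ < r₂` and with the
standard structure (inversion chart) on `{‖z‖ > r₁} ∪ {∞}`. [cite: Hatcher2025, Handle Smoothing Theorem (2)] -/
def Glued (_d : GlueData n M) : Type := OnePoint (𝔼 n)

namespace Glued

variable (d : GlueData n M)

/-- The topology of the glued sphere is that of `OnePoint ℝⁿ`. [folklore] -/
instance : TopologicalSpace (Glued d) := inferInstanceAs (TopologicalSpace (OnePoint (𝔼 n)))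

/-- The glued sphere is compact. [folklore] -/
instance : CompactSpace (Glued d) := inferInstanceAs (CompactSpace (OnePoint (𝔼 n)))

/-- The glued sphere is Hausdorff. [folklore] -/
instance : T2Space (Glued d) := inferInstanceAs (T2Space (OnePoint (𝔼 n)))

/-- The identification of the glued sphere with `OnePoint ℝⁿ` (the identity). [folklore] -/
def equivOnePoint : Glued d ≃ OnePoint (𝔼 n) := Equiv.refl _

/-- The same as a homeomorphism. [folklore] -/
def homeomorphOnePoint : Glued d ≃ₜ OnePoint (𝔼 n) := Homeomorph.refl _

/-- **The glued sphere is homeomorphic to `Sⁿ`** (Mathlib's `onePointEquivSphereOfFinrankEq`).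
[folklore] -/
def homeomorphSphere : Glued d ≃ₜ Metric.sphere (0 : EuclideanSpace ℝ (Fin (n + 1))) 1 :=
  (homeomorphOnePoint d).trans (onePointEquivSphereOfFinrankEq (by simp))

/-- The glued sphere is second countable. [folklore] -/
instance : SecondCountableTopology (Glued d) := (homeomorphSphere d).secondCountableTopology

/-- A point of `ℝⁿ` as a point of the glued sphere. [folklore] -/
def pt (z : 𝔼 n) : Glued d := ((z : OnePoint (𝔼 n)) : OnePoint (𝔼 n))

/-- The point at infinity of the glued sphere. [folklore] -/
def infty : Glued d := (OnePoint.infty : OnePoint (𝔼 n))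

/-- `pt` is injective. [folklore] -/
theorem pt_injective : Injective (pt d) := OnePoint.coe_injective

/-- Finite points are not `∞`. [folklore] -/
theorem pt_ne_infty (z : 𝔼 n) : pt d z ≠ infty d := OnePoint.coe_ne_infty z

/-! #### The charts -/

/-- The south charts: `chartAt (F z) ∘ F ∘ coe⁻¹` on `coe '' ball 0 r₂`. [cite: Hatcher2025, Handle Smoothing Theorem (2)] -/
def southChart (z : 𝔼 n) : OpenPartialHomeomorph (Glued d) (𝔼 n) :=
  show OpenPartialHomeomorph (OnePoint (𝔼 n)) (𝔼 n) from
    (coeH.symm.trans d.Fb).trans (chartAt (𝔼 n) (d.F z))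

/-- The north chart: inversion on `{‖z‖ > r₁} ∪ {∞}`. [cite: MilnorTDV1965, §1] -/
def northChart' : OpenPartialHomeomorph (Glued d) (𝔼 n) :=
  show OpenPartialHomeomorph (OnePoint (𝔼 n)) (𝔼 n) from northChart d.r₁ d.r₁_pos

/-- Formula for the south charts. [folklore] -/
theorem southChart_apply (z : 𝔼 n) (p : Glued d) :
    southChart d z p = chartAt (𝔼 n) (d.F z) (d.F ((coeH (n := n)).symm p)) := rfl

/-- Formula for the south charts at finite points. [folklore] -/
theorem southChart_apply_pt (z w : 𝔼 n) :
    southChart d z (pt d w) = chartAt (𝔼 n) (d.F z) (d.F w) := by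
  rw [southChart_apply]
  show chartAt (𝔼 n) (d.F z) (d.F ((coeH (n := n)).symm (w : OnePoint (𝔼 n)))) = _
  rw [coeH_symm_coe]

/-- Formula for the inverses of the south charts. [folklore] -/
theorem southChart_symm_apply (z : 𝔼 n) (x : 𝔼 n) :
    (southChart d z).symm x = pt d (d.F.symm ((chartAt (𝔼 n) (d.F z)).symm x)) := rfl

/-- The source of a south chart. [folklore] -/
theorem mem_southChart_source {z : 𝔼 n} {p : Glued d} :
    p ∈ (southChart d z).source ↔
      ∃ w : 𝔼 n, pt d w = p ∧ w ∈ ball (0 : 𝔼 n) d.r₂ ∧ d.F w ∈ (chartAt (𝔼 n) (d.F z)).source := by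
  constructor
  · intro hp
    have hp' := hp
    simp only [southChart, OpenPartialHomeomorph.trans_source, OpenPartialHomeomorph.symm_source]
      at hp'
    obtain ⟨⟨hpt, hFb⟩, hch⟩ := hp'
    rw [coeH_target] at hpt
    obtain ⟨w, rfl⟩ := hpt
    refine ⟨w, rfl, ?_, ?_⟩
    · have : (coeH (n := n)).symm (w : OnePoint (𝔼 n)) ∈ d.Fb.source := hFb
      rwa [coeH_symm_coe, d.Fb_source] at this
    · have : d.Fb ((coeH (n := n)).symm (w : OnePoint (𝔼 n))) ∈ (chartAt (𝔼 n) (d.F z)).source :=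
        hch
      rwa [coeH_symm_coe] at this
  · rintro ⟨w, rfl, hw, hch⟩
    simp only [southChart, OpenPartialHomeomorph.trans_source, OpenPartialHomeomorph.symm_source]
    refine ⟨⟨?_, ?_⟩, ?_⟩
    · rw [coeH_target]; exact ⟨w, rfl⟩
    · show (coeH (n := n)).symm (w : OnePoint (𝔼 n)) ∈ d.Fb.source
      rw [coeH_symm_coe, d.Fb_source]; exact hw
    · show d.Fb ((coeH (n := n)).symm (w : OnePoint (𝔼 n))) ∈ (chartAt (𝔼 n) (d.F z)).source
      rwa [coeH_symm_coe]

/-- Finite points in the source of a south chart. [folklore] -/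
theorem pt_mem_southChart_source {z w : 𝔼 n} :
    pt d w ∈ (southChart d z).source ↔
      w ∈ ball (0 : 𝔼 n) d.r₂ ∧ d.F w ∈ (chartAt (𝔼 n) (d.F z)).source := by
  rw [mem_southChart_source]
  constructor
  · rintro ⟨w', hw', h1, h2⟩
    obtain rfl := pt_injective d hw'
    exact ⟨h1, h2⟩
  · rintro ⟨h1, h2⟩
    exact ⟨w, rfl, h1, h2⟩

/-- `pt z` lies in the source of the south chart at `z`. [folklore] -/
theorem pt_mem_southChart_source_self {z : 𝔼 n} (hz : z ∈ ball (0 : 𝔼 n) d.r₂) :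
    pt d z ∈ (southChart d z).source :=
  (pt_mem_southChart_source d).2 ⟨hz, mem_chart_source _ _⟩

/-- The target of a south chart. [folklore] -/
theorem mem_southChart_target {z : 𝔼 n} {x : 𝔼 n} :
    x ∈ (southChart d z).target ↔
      x ∈ (chartAt (𝔼 n) (d.F z)).target ∧
        (chartAt (𝔼 n) (d.F z)).symm x ∈ d.F '' ball (0 : 𝔼 n) d.r₂ := by
  simp only [southChart, OpenPartialHomeomorph.trans_target, OpenPartialHomeomorph.symm_target,
    mem_inter_iff, mem_preimage, coeH_source, preimage_univ, inter_univ]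
  rw [d.Fb_target]

/-- A finite point lies in the source of the north chart iff `r₁ < ‖z‖`. [folklore] -/
theorem pt_mem_northChart'_source {z : 𝔼 n} : pt d z ∈ (northChart' d).source ↔ d.r₁ < ‖z‖ :=
  coe_mem_northChart_source d.r₁_pos

/-- `∞` lies in the source of the north chart. [folklore] -/
theorem infty_mem_northChart'_source : infty d ∈ (northChart' d).source :=
  infty_mem_northChart_source d.r₁_pos

/-- The north chart at finite points is the inversion. [folklore] -/
theorem northChart'_apply_pt (z : 𝔼 n) : northChart' d (pt d z) = sInv z := rfl

/-- The north chart sends `∞` to `0`. [folklore] -/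
theorem northChart'_apply_infty : northChart' d (infty d) = 0 := rfl

/-- The inverse of the north chart away from `0`. [folklore] -/
theorem northChart'_symm_apply_of_ne_zero {w : 𝔼 n} (hw : w ≠ 0) :
    (northChart' d).symm w = pt d (sInv w) :=
  northInv_of_ne_zero hw

/-- The inverse of the north chart sends `0` to `∞`. [folklore] -/
theorem northChart'_symm_apply_zero : (northChart' d).symm 0 = infty d := northInv_zero

/-- The target of the north chart is `ball 0 r₁⁻¹`. [folklore] -/
theorem northChart'_target : (northChart' d).target = ball 0 d.r₁⁻¹ := rfl

/-- Every point is either in the image of the ball of radius `r₂` or in the source of the north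
chart. [folklore] -/
theorem mem_northChart'_source_of_not_exists {p : Glued d}
    (h : ¬ ∃ z ∈ ball (0 : 𝔼 n) d.r₂, pt d z = p) : p ∈ (northChart' d).source := by
  induction p using OnePoint.rec with
  | infty => exact infty_mem_northChart'_source d
  | coe z =>
    change pt d z ∈ (northChart' d).source
    rw [pt_mem_northChart'_source]
    by_contra hle
    push Not at hle
    exact h ⟨z, by rw [mem_ball, dist_zero_right]; exact lt_of_le_of_lt hle d.r₁_lt_r₂, rfl⟩

open scoped Classical in
/-- **The charted space structure of the glued sphere.** [cite: Hatcher2025, Handle Smoothing Theorem (2)] -/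
instance instChartedSpace : ChartedSpace (𝔼 n) (Glued d) where
  atlas := (Set.range fun z : ball (0 : 𝔼 n) d.r₂ => southChart d z) ∪ {northChart' d}
  chartAt p :=
    if h : ∃ z ∈ ball (0 : 𝔼 n) d.r₂, pt d z = p then southChart d h.choose else northChart' d
  mem_chart_source p := by
    by_cases h : ∃ z ∈ ball (0 : 𝔼 n) d.r₂, pt d z = p
    · rw [dif_pos h]
      obtain ⟨hz, hp⟩ := h.choose_spec
      have key := pt_mem_southChart_source_self d hz
      rwa [hp] at key
    · rw [dif_neg h]
      exact mem_northChart'_source_of_not_exists d h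
  chart_mem_atlas p := by
    by_cases h : ∃ z ∈ ball (0 : 𝔼 n) d.r₂, pt d z = p
    · rw [dif_pos h]
      exact Or.inl ⟨⟨h.choose, h.choose_spec.1⟩, rfl⟩
    · rw [dif_neg h]
      exact Or.inr rfl

open scoped Classical in
/-- The preferred chart at a point (definitional unfolding). [folklore] -/
theorem chartAt_eq (p : Glued d) :
    chartAt (𝔼 n) p =
      if h : ∃ z ∈ ball (0 : 𝔼 n) d.r₂, pt d z = p then southChart d h.choose
      else northChart' d := rfl

/-- South charts belong to the atlas. [folklore] -/
theorem southChart_mem_atlas {z : 𝔼 n} (hz : z ∈ ball (0 : 𝔼 n) d.r₂) :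
    southChart d z ∈ atlas (𝔼 n) (Glued d) :=
  Or.inl ⟨⟨z, hz⟩, rfl⟩

/-- The north chart belongs to the atlas. [folklore] -/
theorem northChart'_mem_atlas : northChart' d ∈ atlas (𝔼 n) (Glued d) := Or.inr rfl

/-- Description of the atlas of the glued sphere. [folklore] -/
theorem mem_atlas_iff {e : OpenPartialHomeomorph (Glued d) (𝔼 n)} :
    e ∈ atlas (𝔼 n) (Glued d) ↔
      (∃ z ∈ ball (0 : 𝔼 n) d.r₂, e = southChart d z) ∨ e = northChart' d := by
  change e ∈ (Set.range fun z : ball (0 : 𝔼 n) d.r₂ => southChart d z) ∪ {northChart' d} ↔ _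
  simp only [mem_union, mem_range, mem_singleton_iff, Subtype.exists, exists_prop]
  constructor
  · rintro (⟨z, hz, h⟩ | h)
    · exact Or.inl ⟨z, hz, h.symm⟩
    · exact Or.inr h
  · rintro (⟨z, hz, h⟩ | h)
    · exact Or.inl ⟨z, hz, h.symm⟩
    · exact Or.inr h


/-! #### Compatibility of the charts -/

section Compat

/-- Points of the source of a transition map between two south charts. [folklore] -/
theorem southChart_symm_trans_southChart {z w : 𝔼 n} {x : 𝔼 n}
    (hx : x ∈ ((southChart d z).symm.trans (southChart d w)).source) :
    x ∈ (chartAt (𝔼 n) (d.F z)).target ∧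
      (chartAt (𝔼 n) (d.F z)).symm x ∈ (chartAt (𝔼 n) (d.F w)).source ∧
      ((southChart d z).symm.trans (southChart d w)) x =
        chartAt (𝔼 n) (d.F w) ((chartAt (𝔼 n) (d.F z)).symm x) := by
  rw [OpenPartialHomeomorph.trans_source, OpenPartialHomeomorph.symm_source, mem_inter_iff,
    mem_preimage] at hx
  obtain ⟨hx, hx'⟩ := hx
  rw [mem_southChart_target] at hx
  obtain ⟨hxC, u, hu, hFu⟩ := hx
  have hus : u ∈ d.F.source := d.ball_subset hu
  have hsymm : d.F.symm ((chartAt (𝔼 n) (d.F z)).symm x) = u := by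
    rw [← hFu, d.F.left_inv hus]
  rw [southChart_symm_apply, hsymm, pt_mem_southChart_source] at hx'
  refine ⟨hxC, ?_, ?_⟩
  · rw [← hFu]; exact hx'.2
  · rw [OpenPartialHomeomorph.trans_apply, southChart_symm_apply, hsymm, southChart_apply_pt, hFu]

/-- South–south transition maps are `C^∞` (they are transition maps of `M`). [folklore] -/
theorem contDiffOn_southChart_symm_trans_southChart [IsManifold (𝓡 n) ∞ M] (z w : 𝔼 n) :
    ContDiffOn ℝ ∞ ((southChart d z).symm.trans (southChart d w))
      ((southChart d z).symm.trans (southChart d w)).source := by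
  rw [← contMDiffOn_iff_contDiffOn]
  have h1 : ContMDiffOn (𝓡 n) (𝓡 n) ∞ (chartAt (𝔼 n) (d.F z)).symm (chartAt (𝔼 n) (d.F z)).target :=
    contMDiffOn_chart_symm
  have h2 : ContMDiffOn (𝓡 n) (𝓡 n) ∞ (chartAt (𝔼 n) (d.F w)) (chartAt (𝔼 n) (d.F w)).source :=
    contMDiffOn_chart
  have key : ContMDiffOn (𝓡 n) (𝓡 n) ∞
      (chartAt (𝔼 n) (d.F w) ∘ (chartAt (𝔼 n) (d.F z)).symm)
      ((chartAt (𝔼 n) (d.F z)).target ∩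
        (chartAt (𝔼 n) (d.F z)).symm ⁻¹' (chartAt (𝔼 n) (d.F w)).source) :=
    h2.comp (h1.mono inter_subset_left) (fun x hx => hx.2)
  refine (key.mono ?_).congr ?_
  · intro x hx
    obtain ⟨h1, h2, -⟩ := southChart_symm_trans_southChart d hx
    exact ⟨h1, h2⟩
  · intro x hx
    exact (southChart_symm_trans_southChart d hx).2.2

/-- Points of the source of the transition map from a south chart to the north chart. [folklore] -/
theorem southChart_symm_trans_northChart' {z : 𝔼 n} {x : 𝔼 n}
    (hx : x ∈ ((southChart d z).symm.trans (northChart' d)).source) :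
    x ∈ (chartAt (𝔼 n) (d.F z)).target ∧
      (chartAt (𝔼 n) (d.F z)).symm x ∈ d.F '' d.shell ∧
      d.F.symm ((chartAt (𝔼 n) (d.F z)).symm x) ≠ 0 ∧
      ((southChart d z).symm.trans (northChart' d)) x =
        sInv (d.F.symm ((chartAt (𝔼 n) (d.F z)).symm x)) := by
  rw [OpenPartialHomeomorph.trans_source, OpenPartialHomeomorph.symm_source, mem_inter_iff,
    mem_preimage] at hx
  obtain ⟨hx, hx'⟩ := hx
  rw [mem_southChart_target] at hx
  obtain ⟨hxC, u, hu, hFu⟩ := hx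
  have hus : u ∈ d.F.source := d.ball_subset hu
  have hsymm : d.F.symm ((chartAt (𝔼 n) (d.F z)).symm x) = u := by
    rw [← hFu, d.F.left_inv hus]
  rw [southChart_symm_apply, hsymm, pt_mem_northChart'_source] at hx'
  have hu0 : u ≠ 0 := norm_pos_iff.1 (d.r₁_pos.trans hx')
  refine ⟨hxC, ?_, ?_, ?_⟩
  · rw [← hFu]
    refine ⟨u, ⟨hx', ?_⟩, rfl⟩
    rw [mem_ball, dist_zero_right] at hu; exact hu
  · rwa [hsymm]
  · rw [OpenPartialHomeomorph.trans_apply, southChart_symm_apply, hsymm, northChart'_apply_pt]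

/-- The transition map from a south chart to the north chart is `C^∞` (it is
`inversion ∘ F⁻¹ ∘ chart⁻¹` over the shell, where `F⁻¹` is smooth). [folklore] -/
theorem contDiffOn_southChart_symm_trans_northChart' [IsManifold (𝓡 n) ∞ M] (z : 𝔼 n) :
    ContDiffOn ℝ ∞ ((southChart d z).symm.trans (northChart' d))
      ((southChart d z).symm.trans (northChart' d)).source := by
  rw [← contMDiffOn_iff_contDiffOn]
  have h1 : ContMDiffOn (𝓡 n) (𝓡 n) ∞ (chartAt (𝔼 n) (d.F z)).symm (chartAt (𝔼 n) (d.F z)).target :=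
    contMDiffOn_chart_symm
  have h2 := d.contMDiffOn_symm
  have h3 : ContMDiffOn 𝓘(ℝ, 𝔼 n) 𝓘(ℝ, 𝔼 n) ∞ (sInv : 𝔼 n → 𝔼 n) {z | z ≠ 0} :=
    contMDiffOn_iff_contDiffOn.2 contDiffOn_sInv
  have key : ContMDiffOn (𝓡 n) 𝓘(ℝ, 𝔼 n) ∞
      (sInv ∘ d.F.symm ∘ (chartAt (𝔼 n) (d.F z)).symm)
      {x | x ∈ (chartAt (𝔼 n) (d.F z)).target ∧
        (chartAt (𝔼 n) (d.F z)).symm x ∈ d.F '' d.shell ∧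
        d.F.symm ((chartAt (𝔼 n) (d.F z)).symm x) ≠ 0} := by
    refine h3.comp ((h2.comp (h1.mono fun x hx => hx.1) fun x hx => hx.2.1)) fun x hx => hx.2.2
  refine (key.mono ?_).congr ?_
  · intro x hx
    obtain ⟨h1, h2, h3, -⟩ := southChart_symm_trans_northChart' d hx
    exact ⟨h1, h2, h3⟩
  · intro x hx
    exact (southChart_symm_trans_northChart' d hx).2.2.2

/-- Points of the source of the transition map from the north chart to a south chart. [folklore] -/
theorem northChart'_symm_trans_southChart {w : 𝔼 n} {x : 𝔼 n}
    (hx : x ∈ ((northChart' d).symm.trans (southChart d w)).source) :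
    x ≠ 0 ∧ sInv x ∈ d.shell ∧ d.F (sInv x) ∈ (chartAt (𝔼 n) (d.F w)).source ∧
      ((northChart' d).symm.trans (southChart d w)) x = chartAt (𝔼 n) (d.F w) (d.F (sInv x)) := by
  rw [OpenPartialHomeomorph.trans_source, OpenPartialHomeomorph.symm_source, mem_inter_iff,
    mem_preimage, northChart'_target, mem_ball, dist_zero_right] at hx
  obtain ⟨hx, hx'⟩ := hx
  have hx0 : x ≠ 0 := by
    rintro rfl
    rw [northChart'_symm_apply_zero, mem_southChart_source] at hx'
    obtain ⟨u, hu, -⟩ := hx'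
    exact pt_ne_infty d u hu
  rw [northChart'_symm_apply_of_ne_zero d hx0, pt_mem_southChart_source] at hx'
  have hxpos : 0 < ‖x‖ := norm_pos_iff.2 hx0
  refine ⟨hx0, ⟨?_, ?_⟩, hx'.2, ?_⟩
  · rw [norm_sInv]
    rwa [lt_inv_comm₀ d.r₁_pos hxpos]
  · have := hx'.1
    rw [mem_ball, dist_zero_right] at this
    exact this
  · rw [OpenPartialHomeomorph.trans_apply, northChart'_symm_apply_of_ne_zero d hx0,
      southChart_apply_pt]

/-- The transition map from the north chart to a south chart is `C^∞` (it is
`chart ∘ F ∘ inversion`, landing in the shell where `F` is smooth). [folklore] -/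
theorem contDiffOn_northChart'_symm_trans_southChart [IsManifold (𝓡 n) ∞ M] (w : 𝔼 n) :
    ContDiffOn ℝ ∞ ((northChart' d).symm.trans (southChart d w))
      ((northChart' d).symm.trans (southChart d w)).source := by
  rw [← contMDiffOn_iff_contDiffOn]
  have h1 : ContMDiffOn 𝓘(ℝ, 𝔼 n) 𝓘(ℝ, 𝔼 n) ∞ (sInv : 𝔼 n → 𝔼 n) {z | z ≠ 0} :=
    contMDiffOn_iff_contDiffOn.2 contDiffOn_sInv
  have h2 := d.contMDiffOn
  have h3 : ContMDiffOn (𝓡 n) (𝓡 n) ∞ (chartAt (𝔼 n) (d.F w)) (chartAt (𝔼 n) (d.F w)).source :=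
    contMDiffOn_chart
  have key : ContMDiffOn 𝓘(ℝ, 𝔼 n) (𝓡 n) ∞
      (chartAt (𝔼 n) (d.F w) ∘ d.F ∘ sInv)
      {x | x ≠ 0 ∧ sInv x ∈ d.shell ∧ d.F (sInv x) ∈ (chartAt (𝔼 n) (d.F w)).source} :=
    h3.comp (h2.comp (h1.mono fun x hx => hx.1) fun x hx => hx.2.1) fun x hx => hx.2.2
  refine (key.mono ?_).congr ?_
  · intro x hx
    obtain ⟨h1, h2, h3, -⟩ := northChart'_symm_trans_southChart d hx
    exact ⟨h1, h2, h3⟩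
  · intro x hx
    exact (northChart'_symm_trans_southChart d hx).2.2.2

/-- The self-transition of the north chart is the identity, hence `C^∞`. [folklore] -/
theorem contDiffOn_northChart'_symm_trans_northChart' :
    ContDiffOn ℝ ∞ ((northChart' d).symm.trans (northChart' d))
      ((northChart' d).symm.trans (northChart' d)).source := by
  refine contDiffOn_id.congr fun x hx => ?_
  rw [OpenPartialHomeomorph.trans_source, OpenPartialHomeomorph.symm_source] at hx
  rw [OpenPartialHomeomorph.trans_apply]
  exact (northChart' d).right_inv hx.1

/-- **The glued sphere is a `C^∞` manifold.** [cite: Hatcher2025, Handle Smoothing Theorem (2)] -/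
instance instIsManifold [IsManifold (𝓡 n) ∞ M] : IsManifold (𝓡 n) ∞ (Glued d) := by
  refine isManifold_of_contDiffOn (𝓡 n) ∞ (Glued d) ?_
  intro e e' he he'
  simp only [modelWithCornersSelf_coe, modelWithCornersSelf_coe_symm, Function.id_comp,
    Function.comp_id, preimage_id_eq, id_eq, range_id, inter_univ]
  rcases (mem_atlas_iff d).1 he with ⟨z, -, rfl⟩ | rfl <;>
    rcases (mem_atlas_iff d).1 he' with ⟨w, -, rfl⟩ | rfl
  · exact contDiffOn_southChart_symm_trans_southChart d z w
  · exact contDiffOn_southChart_symm_trans_northChart' d z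
  · exact contDiffOn_northChart'_symm_trans_southChart d w
  · exact contDiffOn_northChart'_symm_trans_northChart' d

/-! #### Smoothness of the structure maps -/

/-- **`F ∘ coe⁻¹ : Glued d → M` is `C^∞` on `coe '' ball 0 r₂`** (by construction of the south
charts). [folklore] -/
theorem contMDiffOn_F_comp_coeH_symm [IsManifold (𝓡 n) ∞ M] :
    ContMDiffOn (𝓡 n) (𝓡 n) ∞ (fun p : Glued d => d.F ((coeH (n := n)).symm p))
      (pt d '' ball (0 : 𝔼 n) d.r₂) := by
  rintro _ ⟨z, hz, rfl⟩
  refine ContMDiffAt.contMDiffWithinAt ?_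
  have hmem := pt_mem_southChart_source_self d hz
  have hsrc : (southChart d z).source ∈ 𝓝 (pt d z) := (southChart d z).open_source.mem_nhds hmem
  have h1 : ContMDiffOn (𝓡 n) (𝓡 n) ∞ (southChart d z) (southChart d z).source :=
    contMDiffOn_of_mem_maximalAtlas (IsManifold.subset_maximalAtlas (southChart_mem_atlas d hz))
  have h2 : ContMDiffOn (𝓡 n) (𝓡 n) ∞ (chartAt (𝔼 n) (d.F z)).symm (chartAt (𝔼 n) (d.F z)).target :=
    contMDiffOn_chart_symm
  have key : ContMDiffOn (𝓡 n) (𝓡 n) ∞ ((chartAt (𝔼 n) (d.F z)).symm ∘ southChart d z)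
      (southChart d z).source :=
    h2.comp h1 fun p hp => ((mem_southChart_target d).1 ((southChart d z).map_source hp)).1
  have hev : (fun p : Glued d => d.F ((coeH (n := n)).symm p)) =ᶠ[𝓝 (pt d z)]
      ((chartAt (𝔼 n) (d.F z)).symm ∘ southChart d z) := by
    filter_upwards [hsrc] with p hp
    obtain ⟨w, rfl, -, hw⟩ := (mem_southChart_source d).1 hp
    show d.F ((coeH (n := n)).symm (w : OnePoint (𝔼 n))) = _
    rw [Function.comp_apply, southChart_apply_pt, coeH_symm_coe,
      (chartAt (𝔼 n) (d.F z)).left_inv hw]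
  exact ((key.contMDiffAt hsrc).congr_of_eventuallyEq hev)

/-- **`coe ∘ F⁻¹ : M → Glued d` is `C^∞` on `F '' ball 0 r₂`.** [folklore] -/
theorem contMDiffOn_pt_comp_F_symm [IsManifold (𝓡 n) ∞ M] :
    ContMDiffOn (𝓡 n) (𝓡 n) ∞ (fun m : M => pt d (d.F.symm m)) (d.F '' ball (0 : 𝔼 n) d.r₂) := by
  rintro _ ⟨z, hz, rfl⟩
  refine ContMDiffAt.contMDiffWithinAt ?_
  set C := chartAt (𝔼 n) (d.F z) with hC
  have hU : IsOpen (C.source ∩ d.F '' ball (0 : 𝔼 n) d.r₂) :=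
    C.open_source.inter (d.F.isOpen_image_of_subset_source isOpen_ball d.ball_subset)
  have hmemU : d.F z ∈ C.source ∩ d.F '' ball (0 : 𝔼 n) d.r₂ :=
    ⟨mem_chart_source _ _, z, hz, rfl⟩
  have h1 : ContMDiffOn (𝓡 n) (𝓡 n) ∞ C C.source := contMDiffOn_chart
  have h2 : ContMDiffOn (𝓡 n) (𝓡 n) ∞ (southChart d z).symm (southChart d z).target :=
    contMDiffOn_symm_of_mem_maximalAtlas (IsManifold.subset_maximalAtlas (southChart_mem_atlas d hz))
  have hmaps : ∀ m ∈ C.source ∩ d.F '' ball (0 : 𝔼 n) d.r₂, C m ∈ (southChart d z).target := by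
    rintro m ⟨hm, hm'⟩
    rw [mem_southChart_target]
    exact ⟨C.map_source hm, by rwa [C.left_inv hm]⟩
  have key : ContMDiffOn (𝓡 n) (𝓡 n) ∞ ((southChart d z).symm ∘ C)
      (C.source ∩ d.F '' ball (0 : 𝔼 n) d.r₂) :=
    h2.comp (h1.mono inter_subset_left) hmaps
  have hev : (fun m : M => pt d (d.F.symm m)) =ᶠ[𝓝 (d.F z)] ((southChart d z).symm ∘ C) := by
    filter_upwards [hU.mem_nhds hmemU] with m hm
    rw [Function.comp_apply, southChart_symm_apply, C.left_inv hm.1]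
  exact (key.contMDiffAt (hU.mem_nhds hmemU)).congr_of_eventuallyEq hev

/-- **The inclusion `ℝⁿ → Glued d` is `C^∞` on `{‖z‖ > r₁}`** (it reads as the inversion in the
north chart). [folklore] -/
theorem contMDiffOn_pt [IsManifold (𝓡 n) ∞ M] :
    ContMDiffOn 𝓘(ℝ, 𝔼 n) (𝓡 n) ∞ (pt d) {z : 𝔼 n | d.r₁ < ‖z‖} := by
  have h1 : ContMDiffOn 𝓘(ℝ, 𝔼 n) 𝓘(ℝ, 𝔼 n) ∞ (sInv : 𝔼 n → 𝔼 n) {z | z ≠ 0} :=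
    contMDiffOn_iff_contDiffOn.2 contDiffOn_sInv
  have h2 : ContMDiffOn 𝓘(ℝ, 𝔼 n) (𝓡 n) ∞ (northChart' d).symm (northChart' d).target :=
    contMDiffOn_symm_of_mem_maximalAtlas (IsManifold.subset_maximalAtlas (northChart'_mem_atlas d))
  have hmaps : ∀ z ∈ {z : 𝔼 n | d.r₁ < ‖z‖}, sInv z ∈ (northChart' d).target := by
    intro z hz
    have hz0 : 0 < ‖z‖ := d.r₁_pos.trans hz
    rw [northChart'_target, mem_ball, dist_zero_right, norm_sInv]
    exact (inv_lt_inv₀ hz0 d.r₁_pos).2 hz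
  have key : ContMDiffOn 𝓘(ℝ, 𝔼 n) (𝓡 n) ∞ ((northChart' d).symm ∘ sInv) {z : 𝔼 n | d.r₁ < ‖z‖} :=
    h2.comp (h1.mono fun z hz => norm_pos_iff.1 (d.r₁_pos.trans hz)) hmaps
  refine key.congr fun z hz => ?_
  have hz0 : z ≠ 0 := norm_pos_iff.1 (d.r₁_pos.trans hz)
  rw [Function.comp_apply, northChart'_symm_apply_of_ne_zero d (sInv_ne_zero hz0), sInv_sInv]

/-- **The coordinate `coe⁻¹ : Glued d → ℝⁿ` is `C^∞` on `coe '' {‖z‖ > r₁}`.** [folklore] -/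
theorem contMDiffOn_coeH_symm [IsManifold (𝓡 n) ∞ M] :
    ContMDiffOn (𝓡 n) 𝓘(ℝ, 𝔼 n) ∞ (fun p : Glued d => (coeH (n := n)).symm p)
      (pt d '' {z : 𝔼 n | d.r₁ < ‖z‖}) := by
  have h1 : ContMDiffOn (𝓡 n) 𝓘(ℝ, 𝔼 n) ∞ (northChart' d) (northChart' d).source :=
    contMDiffOn_of_mem_maximalAtlas (IsManifold.subset_maximalAtlas (northChart'_mem_atlas d))
  have h2 : ContMDiffOn 𝓘(ℝ, 𝔼 n) 𝓘(ℝ, 𝔼 n) ∞ (sInv : 𝔼 n → 𝔼 n) {z | z ≠ 0} :=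
    contMDiffOn_iff_contDiffOn.2 contDiffOn_sInv
  have hsub : pt d '' {z : 𝔼 n | d.r₁ < ‖z‖} ⊆ (northChart' d).source := by
    rintro _ ⟨z, hz, rfl⟩; exact (pt_mem_northChart'_source d).2 hz
  have hmaps : ∀ p ∈ pt d '' {z : 𝔼 n | d.r₁ < ‖z‖}, northChart' d p ∈ {z : 𝔼 n | z ≠ 0} := by
    rintro _ ⟨z, hz, rfl⟩
    rw [northChart'_apply_pt]
    exact sInv_ne_zero (norm_pos_iff.1 (d.r₁_pos.trans hz))
  have key : ContMDiffOn (𝓡 n) 𝓘(ℝ, 𝔼 n) ∞ (sInv ∘ northChart' d)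
      (pt d '' {z : 𝔼 n | d.r₁ < ‖z‖}) :=
    h2.comp (h1.mono hsub) hmaps
  refine key.congr ?_
  rintro _ ⟨z, hz, rfl⟩
  show (coeH (n := n)).symm (z : OnePoint (𝔼 n)) = _
  rw [Function.comp_apply, northChart'_apply_pt, sInv_sInv, coeH_symm_coe]

end Compat

end Glued


/-! ## Part 2: caps and the normalised diffeomorphism -/

/-! ### The standard glue data and the standard sphere `P` -/

namespace GlueData

variable {M : Type*} [TopologicalSpace M] [ChartedSpace (𝔼 n) M] (d : GlueData n M)

/-- **The standard glue data** with the same radii as `d`: `F = id` on `ℝⁿ`. Its glued sphere is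
`ℝⁿ ∪ {∞}` with its standard (conformal) smooth structure. [folklore] -/
def std : GlueData n (𝔼 n) where
  F := OpenPartialHomeomorph.refl (𝔼 n)
  r₁ := d.r₁
  r₂ := d.r₂
  r₁_pos := d.r₁_pos
  r₁_lt_r₂ := d.r₁_lt_r₂
  ball_subset := subset_univ _
  contMDiffOn := contMDiff_id.contMDiffOn
  contMDiffOn_symm := contMDiff_id.contMDiffOn

/-- The radii of `d.std` are those of `d`. [folklore] -/
@[simp] theorem std_r₁ : d.std.r₁ = d.r₁ := rfl

/-- The radii of `d.std` are those of `d`. [folklore] -/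
@[simp] theorem std_r₂ : d.std.r₂ = d.r₂ := rfl

/-- The embedding of `d.std` is the identity. [folklore] -/
@[simp] theorem std_F_apply (z : 𝔼 n) : d.std.F z = z := rfl

/-- The inverse of the embedding of `d.std` is the identity. [folklore] -/
@[simp] theorem std_F_symm_apply (z : 𝔼 n) : d.std.F.symm z = z := rfl

end GlueData

namespace Glued

variable {M : Type*} [TopologicalSpace M] [ChartedSpace (𝔼 n) M] (d : GlueData n M)

/-- **The inclusion `ℝⁿ → P` of the standard sphere is smooth everywhere.** [folklore] -/
theorem contMDiff_pt_std : ContMDiff 𝓘(ℝ, 𝔼 n) (𝓡 n) ∞ (pt d.std) := by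
  intro z
  by_cases hz : z ∈ ball (0 : 𝔼 n) d.r₂
  · have h := contMDiffOn_pt_comp_F_symm d.std
    have hset : d.std.F '' ball (0 : 𝔼 n) d.std.r₂ = ball 0 d.r₂ := image_id _
    rw [hset] at h
    exact (h.contMDiffAt (isOpen_ball.mem_nhds hz))
  · have hz' : d.std.r₁ < ‖z‖ := by
      rw [mem_ball, dist_zero_right, not_lt] at hz
      rw [GlueData.std_r₁]; exact d.r₁_lt_r₂.trans_le hz
    exact (contMDiffOn_pt d.std).contMDiffAt
      ((isOpen_lt continuous_const continuous_norm).mem_nhds hz')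

/-- The image of an open set of `ℝⁿ` under `pt` is open. [folklore] -/
theorem isOpen_image_pt {e : GlueData n M} {s : Set (𝔼 n)} (hs : IsOpen s) :
    IsOpen (pt e '' s) :=
  OnePoint.isOpenMap_coe s hs

/-- **The coordinate `coe⁻¹ : P → ℝⁿ` of the standard sphere is smooth at every finite point.**
[folklore] -/
theorem contMDiffOn_coeH_symm_std :
    ContMDiffOn (𝓡 n) 𝓘(ℝ, 𝔼 n) ∞ (fun p : Glued d.std => (coeH (n := n)).symm p)
      (range (pt d.std)) := by
  rintro _ ⟨z, rfl⟩
  refine ContMDiffAt.contMDiffWithinAt ?_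
  by_cases hz : z ∈ ball (0 : 𝔼 n) d.r₂
  · have h := contMDiffOn_F_comp_coeH_symm d.std
    exact h.contMDiffAt ((isOpen_image_pt isOpen_ball).mem_nhds ⟨z, hz, rfl⟩)
  · have hz' : d.std.r₁ < ‖z‖ := by
      rw [mem_ball, dist_zero_right, not_lt] at hz
      rw [GlueData.std_r₁]; exact d.r₁_lt_r₂.trans_le hz
    exact (contMDiffOn_coeH_symm d.std).contMDiffAt
      ((isOpen_image_pt (isOpen_lt continuous_const continuous_norm)).mem_nhds ⟨z, hz', rfl⟩)

/-- The glued sphere is connected when `n ≠ 0`. [folklore] -/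
theorem connectedSpace (e : GlueData n M) (hn : n ≠ 0) : ConnectedSpace (Glued e) := by
  haveI : NeZero n := ⟨hn⟩
  exact inferInstanceAs (ConnectedSpace (OnePoint (𝔼 n)))

end Glued

/-! ### The radial squeeze of `ℝⁿ` onto a ball -/

section Squeeze

variable (ρ lam : ℝ) (hρ : 0 < ρ) (hlam : 0 < lam)

/-- **The radial squeeze** `y ↦ ρ • univUnitBall (λ • y) = ρ λ (1 + λ² ‖y‖²)^{-1/2} • y` of `ℝⁿ`
onto the open ball of radius `ρ`, as an open partial homeomorphism with source `univ`.
[folklore] -/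
def squeeze : OpenPartialHomeomorph (𝔼 n) (𝔼 n) :=
  ((Homeomorph.smulOfNeZero lam hlam.ne').toOpenPartialHomeomorph.trans
    OpenPartialHomeomorph.univUnitBall).trans
    (Homeomorph.smulOfNeZero ρ hρ.ne').toOpenPartialHomeomorph

/-- Formula for the squeeze. [folklore] -/
theorem squeeze_apply (y : 𝔼 n) :
    squeeze ρ lam hρ hlam y = ρ • OpenPartialHomeomorph.univUnitBall (lam • y) := rfl

/-- The source of the squeeze is everything. [folklore] -/
theorem squeeze_source : (squeeze (n := n) ρ lam hρ hlam).source = univ := by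
  simp [squeeze, OpenPartialHomeomorph.univUnitBall]

/-- The target of the squeeze is the open ball of radius `ρ`. [folklore] -/
theorem squeeze_target : (squeeze (n := n) ρ lam hρ hlam).target = ball 0 ρ := by
  ext w
  simp only [squeeze, OpenPartialHomeomorph.trans_target, Homeomorph.toOpenPartialHomeomorph_target,
    OpenPartialHomeomorph.univUnitBall, mem_inter_iff, mem_univ, true_and, mem_preimage,
    Homeomorph.toOpenPartialHomeomorph_symm_apply, Homeomorph.smulOfNeZero_symm_apply, and_true]
  rw [mem_ball_zero_iff, mem_ball_zero_iff, norm_smul, Real.norm_eq_abs, abs_inv, abs_of_pos hρ,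
    inv_mul_lt_iff₀ hρ, mul_one]

/-- The norm of the squeeze: `‖S y‖ = ρ λ ‖y‖ / √(1 + λ² ‖y‖²)`. [folklore] -/
theorem norm_squeeze (y : 𝔼 n) :
    ‖squeeze ρ lam hρ hlam y‖ = ρ * (lam * ‖y‖) / Real.sqrt (1 + (lam * ‖y‖) ^ 2) := by
  rw [squeeze_apply, OpenPartialHomeomorph.univUnitBall_apply, norm_smul, norm_smul, norm_smul,
    Real.norm_eq_abs, abs_of_pos hρ, Real.norm_eq_abs, abs_inv, Real.norm_eq_abs, abs_of_pos hlam,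
    abs_of_nonneg (Real.sqrt_nonneg _)]
  ring

/-- The squeeze commutes with linear isometries. [folklore] -/
theorem squeeze_map (A : 𝔼 n ≃ₗᵢ[ℝ] 𝔼 n) (y : 𝔼 n) :
    squeeze ρ lam hρ hlam (A y) = A (squeeze ρ lam hρ hlam y) := by
  rw [squeeze_apply, squeeze_apply, OpenPartialHomeomorph.univUnitBall_apply,
    OpenPartialHomeomorph.univUnitBall_apply, ← A.map_smul, A.norm_map, ← A.map_smul, ← A.map_smul]

/-- The squeeze vanishes only at the origin. [folklore] -/
theorem squeeze_eq_zero_iff {y : 𝔼 n} : squeeze ρ lam hρ hlam y = 0 ↔ y = 0 := by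
  rw [← norm_eq_zero, norm_squeeze, ← norm_eq_zero (E := 𝔼 n)]
  have h1 : 0 < Real.sqrt (1 + (lam * ‖y‖) ^ 2) := Real.sqrt_pos.2 (by positivity)
  rw [div_eq_zero_iff, mul_eq_zero, mul_eq_zero]
  constructor
  · rintro ((h | h | h) | h)
    · exact absurd h hρ.ne'
    · exact absurd h hlam.ne'
    · exact h
    · exact absurd h h1.ne'
  · intro h; exact Or.inl (Or.inr (Or.inr h))

/-- Squaring `t / √(1 + t²) ≤ c`: `t² ≤ c² (1 + t²)`. [folklore] -/
theorem sq_le_of_div_sqrt_le {t c : ℝ} (ht : 0 ≤ t) (h : t / Real.sqrt (1 + t ^ 2) ≤ c) :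
    t ^ 2 ≤ c ^ 2 * (1 + t ^ 2) := by
  have hs : 0 < Real.sqrt (1 + t ^ 2) := Real.sqrt_pos.2 (by positivity)
  have h2 : t ≤ c * Real.sqrt (1 + t ^ 2) := by rwa [div_le_iff₀ hs] at h
  have h3 : t ^ 2 ≤ (c * Real.sqrt (1 + t ^ 2)) ^ 2 := pow_le_pow_left₀ ht h2 2
  rwa [mul_pow, Real.sq_sqrt (by positivity)] at h3

/-- **Norm control of the squeeze**: if `c ^ 2 * (1 + λ ^ 2) ≤ λ ^ 2`, then `‖S y‖ ≤ ρ c`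
forces `‖y‖ ≤ 1`. [folklore] -/
theorem norm_le_one_of_norm_squeeze_le {c : ℝ} (hcl : c ^ 2 * (1 + lam ^ 2) ≤ lam ^ 2)
    {y : 𝔼 n} (hy : ‖squeeze ρ lam hρ hlam y‖ ≤ ρ * c) : ‖y‖ ≤ 1 := by
  rw [norm_squeeze] at hy
  have ht0 : 0 ≤ lam * ‖y‖ := by positivity
  have h1 : lam * ‖y‖ / Real.sqrt (1 + (lam * ‖y‖) ^ 2) ≤ c := by
    have : ρ * (lam * ‖y‖ / Real.sqrt (1 + (lam * ‖y‖) ^ 2)) ≤ ρ * c := by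
      rwa [mul_div_assoc] at hy
    exact le_of_mul_le_mul_left this hρ
  have h3 := sq_le_of_div_sqrt_le ht0 h1
  -- if `‖y‖ > 1` then `t > λ` and `t² (1 - c²) > λ² (1 - c²) ≥ c²`, contradiction
  by_contra hgt
  rw [not_le] at hgt
  have htl : lam < lam * ‖y‖ := lt_mul_right hlam hgt
  have htl2 : lam ^ 2 < (lam * ‖y‖) ^ 2 := pow_lt_pow_left₀ htl hlam.le two_ne_zero
  have hc1 : c ^ 2 < 1 := by nlinarith [sq_nonneg lam, hlam, sq_nonneg c]
  nlinarith [mul_lt_mul_of_pos_left htl2 (show 0 < 1 - c ^ 2 by linarith), sq_nonneg c]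

/-- The squeeze is `C^∞`. [folklore] -/
theorem contDiff_squeeze : ContDiff ℝ ∞ (squeeze (n := n) ρ lam hρ hlam) := by
  have : (squeeze (n := n) ρ lam hρ hlam : 𝔼 n → 𝔼 n) =
      fun y => ρ • OpenPartialHomeomorph.univUnitBall (lam • y) := rfl
  rw [this]
  exact (OpenPartialHomeomorph.contDiff_univUnitBall.comp (contDiff_const_smul lam)).const_smul ρ

/-- The inverse of the squeeze is `C^∞` on the ball. [folklore] -/
theorem contDiffOn_squeeze_symm :
    ContDiffOn ℝ ∞ (squeeze (n := n) ρ lam hρ hlam).symm (ball 0 ρ) := by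
  have hform : ∀ w, (squeeze (n := n) ρ lam hρ hlam).symm w =
      lam⁻¹ • OpenPartialHomeomorph.univUnitBall.symm (ρ⁻¹ • w) := fun w => rfl
  have h1 : ContDiffOn ℝ ∞ (fun w : 𝔼 n => ρ⁻¹ • w) (ball 0 ρ) := (contDiff_const_smul _).contDiffOn
  have hmaps : MapsTo (fun w : 𝔼 n => ρ⁻¹ • w) (ball 0 ρ) (ball 0 1) := by
    intro w hw
    rw [mem_ball_zero_iff] at hw ⊢
    rw [norm_smul, Real.norm_eq_abs, abs_inv, abs_of_pos hρ, inv_mul_lt_iff₀ hρ, mul_one]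
    exact hw
  have h2 := OpenPartialHomeomorph.contDiffOn_univUnitBall_symm (n := ⊤) (E := 𝔼 n)
  have h3 : ContDiffOn ℝ ∞ (fun w : 𝔼 n => OpenPartialHomeomorph.univUnitBall.symm (ρ⁻¹ • w))
      (ball 0 ρ) := h2.comp h1 hmaps
  exact (h3.const_smul lam⁻¹).congr fun w _ => hform w

end Squeeze

/-! ### The cap parametrisation -/

section Cap

variable {M : Type*} [TopologicalSpace M] [ChartedSpace (𝔼 n) M] (d : GlueData n M) {R : ℝ}
  (hR : d.r₁ < R)

/-- The squeeze parameter `λ = R / (R - r₁)`. [folklore] -/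
def lamOf (d : GlueData n M) (R : ℝ) : ℝ := R / (R - d.r₁)

include hR in
/-- `0 < λ`. [folklore] -/
theorem lamOf_pos : 0 < lamOf d R := div_pos (d.r₁_pos.trans hR) (sub_pos.2 hR)

include hR in
/-- The key inequality `c² (1 + λ²) ≤ λ²` for `c = r₁ / R`. [folklore] -/
theorem lamOf_ineq : (d.r₁ / R) ^ 2 * (1 + lamOf d R ^ 2) ≤ lamOf d R ^ 2 := by
  have h0 : 0 < d.r₁ := d.r₁_pos
  have hR0 : 0 < R := h0.trans hR
  have hsub : 0 < R - d.r₁ := sub_pos.2 hR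
  have hR0' : R ≠ 0 := hR0.ne'
  have hsub' : R - d.r₁ ≠ 0 := hsub.ne'
  have hc : d.r₁ / R < 1 := (div_lt_one hR0).2 hR
  have hc0 : 0 < d.r₁ / R := div_pos h0 hR0
  have key : lamOf d R ^ 2 * (1 - (d.r₁ / R) ^ 2) = (R + d.r₁) / (R - d.r₁) := by
    rw [lamOf]
    field_simp
    ring
  have hge : 1 ≤ (R + d.r₁) / (R - d.r₁) := by
    rw [le_div_iff₀ hsub]; linarith
  have h2 : (d.r₁ / R) ^ 2 ≤ lamOf d R ^ 2 * (1 - (d.r₁ / R) ^ 2) := by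
    rw [key]; nlinarith
  calc (d.r₁ / R) ^ 2 * (1 + lamOf d R ^ 2)
      = (d.r₁ / R) ^ 2 + (d.r₁ / R) ^ 2 * lamOf d R ^ 2 := by ring
    _ ≤ lamOf d R ^ 2 * (1 - (d.r₁ / R) ^ 2) + (d.r₁ / R) ^ 2 * lamOf d R ^ 2 := by linarith
    _ = lamOf d R ^ 2 := by ring

/-- **The squeeze used for the caps**: onto the target `ball 0 r₁⁻¹` of the north chart, with
parameter `λ = R / (R - r₁)`. [folklore] -/
def capSqueeze : OpenPartialHomeomorph (𝔼 n) (𝔼 n) :=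
  squeeze d.r₁⁻¹ (lamOf d R) (inv_pos.2 d.r₁_pos) (lamOf_pos d hR)

/-- If `‖capSqueeze y‖ ≤ R⁻¹` then `‖y‖ ≤ 1`. [folklore] -/
theorem norm_le_one_of_norm_capSqueeze_le {y : 𝔼 n} (hy : ‖capSqueeze d hR y‖ ≤ R⁻¹) :
    ‖y‖ ≤ 1 := by
  have hR0 : 0 < R := d.r₁_pos.trans hR
  refine norm_le_one_of_norm_squeeze_le d.r₁⁻¹ (lamOf d R) (inv_pos.2 d.r₁_pos) (lamOf_pos d hR)
    (c := d.r₁ / R) (lamOf_ineq d hR) ?_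
  rw [capSqueeze] at hy
  have heq : d.r₁⁻¹ * (d.r₁ / R) = R⁻¹ := by
    rw [div_eq_mul_inv, ← mul_assoc, inv_mul_cancel₀ d.r₁_pos.ne', one_mul]
  rwa [heq]

/-- The source of `capSqueeze` is everything. [folklore] -/
theorem capSqueeze_source : (capSqueeze d hR).source = univ := squeeze_source _ _ _ _

/-- The target of `capSqueeze` is the target `ball 0 r₁⁻¹` of the north chart. [folklore] -/
theorem capSqueeze_target : (capSqueeze d hR).target = ball 0 d.r₁⁻¹ := squeeze_target _ _ _ _

/-- `capSqueeze` commutes with linear isometries. [folklore] -/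
theorem capSqueeze_map (A : 𝔼 n ≃ₗᵢ[ℝ] 𝔼 n) (y : 𝔼 n) :
    capSqueeze d hR (A y) = A (capSqueeze d hR y) := squeeze_map _ _ _ _ A y

/-- `capSqueeze y = 0 ↔ y = 0`. [folklore] -/
theorem capSqueeze_eq_zero_iff {y : 𝔼 n} : capSqueeze d hR y = 0 ↔ y = 0 :=
  squeeze_eq_zero_iff _ _ _ _

/-- `capSqueeze y` lies in the target of the north chart. [folklore] -/
theorem capSqueeze_mem_target (y : 𝔼 n) : capSqueeze d hR y ∈ ball (0 : 𝔼 n) d.r₁⁻¹ := by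
  rw [← capSqueeze_target d hR]
  exact (capSqueeze d hR).map_source (by rw [capSqueeze_source]; exact mem_univ _)

end Cap

section CapEmb

variable {M : Type*} [TopologicalSpace M] [ChartedSpace (𝔼 n) M] (e : GlueData n M) {R : ℝ}
  (hR : e.r₁ < R)

/-- **The cap parametrisation** `j = (north chart)⁻¹ ∘ capSqueeze : ℝⁿ → Glued e`, an open
partial homeomorphism with source `univ` whose closed unit ball covers the cap
`{‖z‖ ≥ R} ∪ {∞}`. [cite: Hatcher2025, Smoothing 2-handles] -/
def capEmb : OpenPartialHomeomorph (𝔼 n) (Glued e) := (capSqueeze e hR).trans (Glued.northChart' e).symm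

/-- Formula for the cap parametrisation. [folklore] -/
theorem capEmb_apply (y : 𝔼 n) : capEmb e hR y = (Glued.northChart' e).symm (capSqueeze e hR y) := rfl

/-- The cap parametrisation at the origin is `∞`. [folklore] -/
theorem capEmb_zero : capEmb e hR 0 = Glued.infty e := by
  rw [capEmb_apply, (capSqueeze_eq_zero_iff e hR).2 rfl, Glued.northChart'_symm_apply_zero]

/-- The cap parametrisation away from the origin. [folklore] -/
theorem capEmb_of_ne_zero {y : 𝔼 n} (hy : y ≠ 0) :
    capEmb e hR y = Glued.pt e (sInv (capSqueeze e hR y)) := by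
  rw [capEmb_apply, Glued.northChart'_symm_apply_of_ne_zero]
  exact fun h => hy ((capSqueeze_eq_zero_iff e hR).1 h)

/-- Equivariance of the cap parametrisation under linear isometries. [folklore] -/
theorem capEmb_map {y : 𝔼 n} (hy : y ≠ 0) (A : 𝔼 n ≃ₗᵢ[ℝ] 𝔼 n) :
    capEmb e hR (A y) = Glued.pt e (A (sInv (capSqueeze e hR y))) := by
  have hAy : A y ≠ 0 := fun h => hy (A.injective (by rw [h, map_zero]))
  rw [capEmb_of_ne_zero e hR hAy, capSqueeze_map, sInv_map]

/-- The source of the cap parametrisation is everything. [folklore] -/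
theorem capEmb_source : (capEmb e hR).source = univ := by
  rw [capEmb, OpenPartialHomeomorph.trans_source, OpenPartialHomeomorph.symm_source,
    capSqueeze_source, univ_inter, eq_univ_iff_forall]
  intro y
  rw [mem_preimage, Glued.northChart'_target]
  exact capSqueeze_mem_target e hR y

/-- The target of the cap parametrisation lies in the source of the north chart. [folklore] -/
theorem capEmb_target_subset : (capEmb e hR).target ⊆ (Glued.northChart' e).source := by
  rw [capEmb, OpenPartialHomeomorph.trans_target, OpenPartialHomeomorph.symm_target]
  exact inter_subset_left

/-- **The cap parametrisation is a smooth embedding of `ℝⁿ`.** [folklore] -/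
theorem isSmoothEmbedding_capEmb [IsManifold (𝓡 n) ∞ M] :
    Manifold.IsSmoothEmbedding 𝓘(ℝ, 𝔼 n) (𝓡 n) ∞ (capEmb e hR) := by
  have hN : Glued.northChart' e ∈ IsManifold.maximalAtlas (𝓡 n) ∞ (Glued e) :=
    IsManifold.subset_maximalAtlas (Glued.northChart'_mem_atlas e)
  refine isSmoothEmbedding_of_openPartialHomeomorph (capEmb e hR) (capEmb_source e hR) ?_ ?_
    (ContinuousLinearEquiv.refl ℝ (𝔼 n))
  · -- smoothness of `j = north⁻¹ ∘ squeeze`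
    have h1 : ContMDiffOn 𝓘(ℝ, 𝔼 n) 𝓘(ℝ, 𝔼 n) ∞ (capSqueeze e hR) univ :=
      contMDiffOn_iff_contDiffOn.2 (contDiff_squeeze _ _ _ _).contDiffOn
    have h2 : ContMDiffOn 𝓘(ℝ, 𝔼 n) (𝓡 n) ∞ (Glued.northChart' e).symm (Glued.northChart' e).target :=
      contMDiffOn_symm_of_mem_maximalAtlas hN
    rw [capEmb_source]
    refine (h2.comp h1 fun y _ => ?_)
    rw [Glued.northChart'_target]; exact capSqueeze_mem_target e hR y
  · -- smoothness of `j⁻¹ = squeeze⁻¹ ∘ north`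
    have h1 : ContMDiffOn (𝓡 n) 𝓘(ℝ, 𝔼 n) ∞ (Glued.northChart' e) (Glued.northChart' e).source :=
      contMDiffOn_of_mem_maximalAtlas hN
    have h2 : ContMDiffOn 𝓘(ℝ, 𝔼 n) 𝓘(ℝ, 𝔼 n) ∞ (capSqueeze e hR).symm (ball 0 e.r₁⁻¹) :=
      contMDiffOn_iff_contDiffOn.2 (contDiffOn_squeeze_symm _ _ _ _)
    have key : ContMDiffOn (𝓡 n) 𝓘(ℝ, 𝔼 n) ∞ ((capSqueeze e hR).symm ∘ Glued.northChart' e)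
        (Glued.northChart' e).source :=
      h2.comp h1 fun p hp => (Glued.northChart' e).map_source hp
    exact key.mono (capEmb_target_subset e hR)

/-- **Points of the cap**: for `R ≤ ‖z‖` the point `y = capSqueeze⁻¹ (sInv z)` has `‖y‖ ≤ 1`,
`y ≠ 0`, `capSqueeze y = sInv z` and `j y = z`. [folklore] -/
theorem exists_capEmb_eq_pt {z : 𝔼 n} (hz : R ≤ ‖z‖) :
    ∃ y : 𝔼 n, ‖y‖ ≤ 1 ∧ y ≠ 0 ∧ sInv (capSqueeze e hR y) = z ∧ capEmb e hR y = Glued.pt e z := by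
  have hR0 : 0 < R := e.r₁_pos.trans hR
  have hz0 : 0 < ‖z‖ := hR0.trans_le hz
  have hz0' : z ≠ 0 := norm_pos_iff.1 hz0
  have hw : sInv z ∈ (capSqueeze e hR).target := by
    rw [capSqueeze_target, mem_ball_zero_iff, norm_sInv]
    exact (inv_lt_inv₀ hz0 e.r₁_pos).2 (hR.trans_le hz)
  set y := (capSqueeze e hR).symm (sInv z) with hy
  have hSy : capSqueeze e hR y = sInv z := (capSqueeze e hR).right_inv hw
  have hy0 : y ≠ 0 := by
    intro h
    have : capSqueeze e hR y = 0 := by rw [h]; exact (capSqueeze_eq_zero_iff e hR).2 rfl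
    rw [hSy] at this
    exact sInv_ne_zero hz0' this
  refine ⟨y, ?_, hy0, by rw [hSy, sInv_sInv], ?_⟩
  · refine norm_le_one_of_norm_capSqueeze_le e hR ?_
    rw [hSy, norm_sInv]
    exact (inv_le_inv₀ hz0 hR0).2 hz
  · rw [capEmb_of_ne_zero e hR hy0, hSy, sInv_sInv]

end CapEmb

/-! ### The normalised diffeomorphism `Θ : Q → P` -/

section Theta

variable {M : Type*} [TopologicalSpace M] [ChartedSpace (𝔼 n) M] [IsManifold (𝓡 n) ∞ M]
  (d : GlueData n M)

/-- A reflection of `ℝⁿ` (`n ≠ 0`): a linear isometry of determinant `-1`. [folklore] -/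
theorem exists_linearIsometryEquiv_det_neg (hn : n ≠ 0) :
    ∃ r : 𝔼 n ≃ₗᵢ[ℝ] 𝔼 n,
      LinearMap.det (r.toContinuousLinearEquiv.toLinearEquiv : 𝔼 n →ₗ[ℝ] 𝔼 n) < 0 := by
  set v : 𝔼 n := EuclideanSpace.single (⟨0, Nat.pos_of_ne_zero hn⟩ : Fin n) (1 : ℝ) with hv_def
  have hv : v ≠ 0 := by
    intro h
    have := congr_fun (congrArg (fun w : 𝔼 n => (w : Fin n → ℝ)) h) ⟨0, Nat.pos_of_ne_zero hn⟩
    simp [hv_def] at this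
  refine ⟨(ℝ ∙ v)ᗮ.reflection, ?_⟩
  have h := ((ℝ ∙ v)ᗮ).det_reflection
  rw [Submodule.orthogonal_orthogonal, finrank_span_singleton hv, pow_one] at h
  have h' : LinearMap.det (((ℝ ∙ v)ᗮ.reflection).toContinuousLinearEquiv.toLinearEquiv :
      𝔼 n →ₗ[ℝ] 𝔼 n) = -1 := h
  rw [h']
  norm_num

/-- **The normalised diffeomorphism `Θ : Q → P`.** Under the smooth Poincaré hypothesis in
dimension `n ≠ 0` there are a diffeomorphism `Θ : Glued d → Glued d.std` and a linear isometry
`A` of `ℝⁿ` with `Θ ∞ = ∞` and `Θ z = A z` for all `‖z‖ ≥ R` (smooth Poincaré twice, then the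
disc theorem in `P` for the caps). [cite: Hatcher2025, Smoothing 2-handles] [cite: Palais1960, Thm. B] -/
theorem exists_diffeomorph_glued_eq_on_cap (hn : n ≠ 0)
    (hSP : ∀ (X : Type) [TopologicalSpace X] [T2Space X] [SecondCountableTopology X],
      ContinuousMap.HomotopyEquiv.NonemptyDiffeomorphSphere X n) {R : ℝ} (hR : d.r₁ < R) :
    ∃ (Θ : Glued d ≃ₘ⟮𝓡 n, 𝓡 n⟯ Glued d.std) (A : 𝔼 n ≃ₗᵢ[ℝ] 𝔼 n),
      Θ (Glued.infty d) = Glued.infty d.std ∧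
        ∀ z : 𝔼 n, R ≤ ‖z‖ → Θ (Glued.pt d z) = Glued.pt d.std (A z) := by
  -- smooth Poincaré, twice
  obtain ⟨eQ⟩ := hSP (Glued d) (Glued.instChartedSpace d) (Glued.instIsManifold d)
    (Glued.homeomorphSphere d).toHomotopyEquiv
  obtain ⟨eP⟩ := hSP (Glued d.std) (Glued.instChartedSpace d.std) (Glued.instIsManifold d.std)
    (Glued.homeomorphSphere d.std).toHomotopyEquiv
  set Θ₀ : Glued d ≃ₘ⟮𝓡 n, 𝓡 n⟯ Glued d.std := eQ.trans eP.symm with hΘ₀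
  -- the disc theorem in `P`
  haveI := Glued.connectedSpace d.std hn
  obtain ⟨r, hr⟩ := exists_linearIsometryEquiv_det_neg hn
  have hi' : Manifold.IsSmoothEmbedding 𝓘(ℝ, 𝔼 n) (𝓡 n) ∞ (capEmb d.std hR) :=
    isSmoothEmbedding_capEmb d.std hR
  have hi : Manifold.IsSmoothEmbedding 𝓘(ℝ, 𝔼 n) (𝓡 n) ∞ (Θ₀ ∘ capEmb d hR) :=
    (isSmoothEmbedding_capEmb d hR).diffeomorph_comp Θ₀
  obtain ⟨τ, -, hτ⟩ := exists_diffeomorph_apply_disc_eq_or_reflect_cs (M := Glued d.std) hn hi hi'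
    r.toContinuousLinearEquiv hr
  refine ⟨Θ₀.trans τ, ?_⟩
  rcases hτ with h | h
  · refine ⟨LinearIsometryEquiv.refl ℝ (𝔼 n), ?_, fun z hz => ?_⟩
    · have h0 := h 0 (by simp)
      rw [Function.comp_apply, capEmb_zero, capEmb_zero] at h0
      exact h0
    · obtain ⟨y, hy1, hy0, hyz, hyQ⟩ := exists_capEmb_eq_pt d hR hz
      obtain ⟨y', hy1', hy0', hyz', hyP⟩ := exists_capEmb_eq_pt d.std hR hz
      -- `y' = y` since the squeezes of `d` and `d.std` coincide
      have hyy : y' = y := by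
        have h1 : sInv (capSqueeze d.std hR y') = sInv (capSqueeze d hR y) := by rw [hyz, hyz']
        have h2 := sInv_injective h1
        have h3 : capSqueeze d hR y' = capSqueeze d hR y := h2
        exact (capSqueeze d hR).injOn (by rw [capSqueeze_source]; trivial)
          (by rw [capSqueeze_source]; trivial) h3
      have hy := h y hy1
      rw [Function.comp_apply, hyQ, ← hyy, hyP] at hy
      simpa using hy
  · refine ⟨r.symm, ?_, fun z hz => ?_⟩
    · have h0 := h 0 (by simp)
      rw [Function.comp_apply, map_zero, capEmb_zero, capEmb_zero] at h0
      exact h0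
    · obtain ⟨y, hy1, hy0, hyz, hyQ⟩ := exists_capEmb_eq_pt d hR hz
      -- apply the disc theorem to `r⁻¹ y`
      have hry : ‖r.symm y‖ ≤ 1 := by rwa [r.symm.norm_map]
      have hy := h (r.symm y) hry
      have hrr : r.toContinuousLinearEquiv (r.symm y) = y := r.apply_symm_apply y
      rw [Function.comp_apply, hrr, hyQ] at hy
      show τ (Θ₀ (Glued.pt d z)) = _
      rw [hy]
      have hry0 : r.symm y ≠ 0 := fun h0 => hy0 (by simpa using congrArg r h0)
      -- `capEmb d.std (r⁻¹ y) = r⁻¹ z`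
      have key := capEmb_map d.std hR hy0 r.symm
      have hsq : sInv (capSqueeze d.std hR y) = z := hyz
      rw [hsq] at key
      exact key

end Theta

/-! ## Part 3: the theorem -/

section Main

variable {M : Type*} [TopologicalSpace M] [ChartedSpace (𝔼 n) M] [IsManifold (𝓡 n) ∞ M]

/-- A bijection of `ℝⁿ` which is the identity on `{‖z‖ ≥ R}` maps every ball of radius `ρ ≥ R`
about the origin into itself. [folklore] -/
theorem mapsTo_ball_of_apply_eq_self {g : 𝔼 n → 𝔼 n} (hg : Injective g) {R : ℝ}
    (hfix : ∀ z, R ≤ ‖z‖ → g z = z) {ρ : ℝ} (hρ : R ≤ ρ) : MapsTo g (ball 0 ρ) (ball 0 ρ) := by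
  intro z hz
  rw [mem_ball_zero_iff] at hz ⊢
  by_cases h : R ≤ ‖z‖
  · rw [hfix z h]; exact hz
  · rw [not_le] at h
    by_contra hge
    rw [not_lt] at hge
    have h1 : g (g z) = g z := hfix (g z) (hρ.trans hge)
    have h2 : g z = z := hg h1
    rw [h2] at hge
    exact absurd (h.trans_le (hρ.trans hge)) (lt_irrefl _)

/-- **Smoothing a disc relative to a shell (Hatcher's Handle Smoothing Theorem (2) / Fact 6,
static form), in dimension `n ≠ 0` under the smooth Poincaré hypothesis in dimension `n`.**
Let `F : ℝⁿ ⇀ M` be an open topological embedding of the ball `‖z‖ < r₂` into a smooth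
`n`-manifold which is a diffeomorphism onto its image on the shell `r₁ < ‖z‖ < r₂` (glue data
`d`), and `r₁ < R ≤ r₂`.  Then there is a homeomorphism `g` of `ℝⁿ` with `g z = z` for
`‖z‖ ≥ R` such that `F ∘ g` is `C^∞` on the ball `‖z‖ < r₂` and `g⁻¹ ∘ F⁻¹` is `C^∞` on its
image: `F ∘ g` is a diffeomorphism of the ball onto `F (ball)` which agrees with `F` on the
outer shell `R ≤ ‖z‖ < r₂`.  (Hatcher: "Every smooth structure on `D²` that is standard near
`∂D²` is diffeomorphic to the standard structure via a diffeomorphism that is the identity near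
`∂D²`", here for the smooth structure `F^*(M)` on the ball, in every dimension where homotopy
spheres are standard; proved from the smooth Poincaré hypothesis, the disc theorem and the
one-point gluing, not by Hatcher's Morse-theoretic argument.)
[cite: Hatcher2025, Handle Smoothing Theorem (2) and Fact 6] -/
theorem exists_homeomorph_smoothing_rel_shell (hn : n ≠ 0)
    (hSP : ∀ (X : Type) [TopologicalSpace X] [T2Space X] [SecondCountableTopology X],
      ContinuousMap.HomotopyEquiv.NonemptyDiffeomorphSphere X n)
    (d : GlueData n M) {R : ℝ} (hR : d.r₁ < R) (hR₂ : R ≤ d.r₂) :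
    ∃ g : 𝔼 n ≃ₜ 𝔼 n, (∀ z, R ≤ ‖z‖ → g z = z) ∧
      ContMDiffOn 𝓘(ℝ, 𝔼 n) (𝓡 n) ∞ (d.F ∘ g) (ball 0 d.r₂) ∧
      ContMDiffOn (𝓡 n) 𝓘(ℝ, 𝔼 n) ∞ (g.symm ∘ d.F.symm) (d.F '' ball 0 d.r₂) := by
  obtain ⟨Θ, A, hΘinf, hΘ⟩ := exists_diffeomorph_glued_eq_on_cap d hn hSP hR
  -- `Θ` and `Θ⁻¹` preserve finiteness
  have hΘinf' : Θ.symm (Glued.infty d.std) = Glued.infty d := by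
    rw [← hΘinf, Diffeomorph.symm_apply_apply]
  have hfinQ : ∀ z : 𝔼 n, Θ (Glued.pt d z) ≠ Glued.infty d.std := fun z h =>
    Glued.pt_ne_infty d z (Θ.injective (h.trans hΘinf.symm))
  have hfinP : ∀ w : 𝔼 n, Θ.symm (Glued.pt d.std w) ≠ Glued.infty d := fun w h =>
    Glued.pt_ne_infty d.std w (Θ.symm.injective (h.trans hΘinf'.symm))
  -- the planar maps
  set gfun : 𝔼 n → 𝔼 n := fun z => (coeH (n := n)).symm (Θ.symm (Glued.pt d.std (A z))) with hgfun
  set ginv : 𝔼 n → 𝔼 n := fun w => A.symm ((coeH (n := n)).symm (Θ (Glued.pt d w))) with hginv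
  have hpt_gfun : ∀ z, Glued.pt d (gfun z) = Θ.symm (Glued.pt d.std (A z)) := fun z =>
    coe_coeH_symm (hfinP (A z))
  have hpt_ginv : ∀ w, Glued.pt d.std (A (ginv w)) = Θ (Glued.pt d w) := fun w => by
    simp only [hginv, LinearIsometryEquiv.apply_symm_apply]
    exact coe_coeH_symm (hfinQ w)
  have hleft : ∀ z, ginv (gfun z) = z := fun z => by
    have h1 : Θ (Glued.pt d (gfun z)) = Glued.pt d.std (A z) := by
      rw [hpt_gfun, Diffeomorph.apply_symm_apply]
    simp only [hginv]
    rw [h1]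
    show A.symm ((coeH (n := n)).symm ((A z : 𝔼 n) : OnePoint (𝔼 n))) = z
    rw [coeH_symm_coe, A.symm_apply_apply]
  have hright : ∀ w, gfun (ginv w) = w := fun w => by
    simp only [hgfun]
    rw [hpt_ginv, Diffeomorph.symm_apply_apply]
    exact coeH_symm_coe w
  have hcont_symm : ContinuousOn (fun p : OnePoint (𝔼 n) => (coeH (n := n)).symm p)
      (range ((↑) : 𝔼 n → OnePoint (𝔼 n))) := by
    rw [← coeH_target]; exact coeH.continuousOn_symm
  have hg_cont : Continuous gfun := by
    refine hcont_symm.comp_continuous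
      (Θ.symm.continuous.comp (OnePoint.continuous_coe.comp A.continuous)) fun z => ?_
    exact OnePoint.ne_infty_iff_exists.1 (hfinP (A z))
  have hginv_cont : Continuous ginv := by
    refine A.symm.continuous.comp (hcont_symm.comp_continuous
      (Θ.continuous.comp OnePoint.continuous_coe) fun w => ?_)
    exact OnePoint.ne_infty_iff_exists.1 (hfinQ w)
  let g : 𝔼 n ≃ₜ 𝔼 n :=
    { toFun := gfun
      invFun := ginv
      left_inv := hleft
      right_inv := hright
      continuous_toFun := hg_cont
      continuous_invFun := hginv_cont }
  have hg_apply : ∀ z, g z = gfun z := fun _ => rfl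
  have hg_symm_apply : ∀ w, g.symm w = ginv w := fun _ => rfl
  -- `g = id` on the cap
  have hfix : ∀ z, R ≤ ‖z‖ → g z = z := fun z hz => by
    rw [hg_apply]
    simp only [hgfun]
    rw [← hΘ z hz, Diffeomorph.symm_apply_apply]
    exact coeH_symm_coe z
  have hmaps : MapsTo g (ball 0 d.r₂) (ball 0 d.r₂) :=
    mapsTo_ball_of_apply_eq_self g.injective hfix hR₂
  refine ⟨g, hfix, ?_, ?_⟩
  · -- `F ∘ g = (F ∘ coe⁻¹) ∘ Θ⁻¹ ∘ (coe ∘ A)` is smooth on the ball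
    have h1 : ContMDiff 𝓘(ℝ, 𝔼 n) (𝓡 n) ∞ (fun z : 𝔼 n => Glued.pt d.std (A z)) :=
      (Glued.contMDiff_pt_std d).comp
        (contMDiff_iff_contDiff.2 A.toContinuousLinearEquiv.contDiff)
    have h2 : ContMDiff (𝓡 n) (𝓡 n) ∞ Θ.symm := Θ.symm.contMDiff
    have h3 := Glued.contMDiffOn_F_comp_coeH_symm d
    have key : ContMDiffOn 𝓘(ℝ, 𝔼 n) (𝓡 n) ∞
        ((fun p : Glued d => d.F ((coeH (n := n)).symm p)) ∘ Θ.symm ∘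
          fun z : 𝔼 n => Glued.pt d.std (A z)) (ball 0 d.r₂) := by
      refine h3.comp (h2.comp h1).contMDiffOn fun z hz => ?_
      show Θ.symm (Glued.pt d.std (A z)) ∈ Glued.pt d '' ball 0 d.r₂
      rw [← hpt_gfun]
      exact ⟨gfun z, hmaps hz, rfl⟩
    exact key.congr fun z _ => rfl
  · -- `g⁻¹ ∘ F⁻¹ = A⁻¹ ∘ coe⁻¹ ∘ Θ ∘ (coe ∘ F⁻¹)` is smooth on the image of the ball
    have k1 := Glued.contMDiffOn_pt_comp_F_symm d
    have k2 : ContMDiff (𝓡 n) (𝓡 n) ∞ Θ := Θ.contMDiff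
    have k3 := Glued.contMDiffOn_coeH_symm_std d
    have k4 : ContMDiff 𝓘(ℝ, 𝔼 n) 𝓘(ℝ, 𝔼 n) ∞ (A.symm : 𝔼 n → 𝔼 n) :=
      contMDiff_iff_contDiff.2 A.symm.toContinuousLinearEquiv.contDiff
    have key : ContMDiffOn (𝓡 n) 𝓘(ℝ, 𝔼 n) ∞
        ((A.symm : 𝔼 n → 𝔼 n) ∘ (fun p : Glued d.std => (coeH (n := n)).symm p) ∘ Θ ∘
          fun m : M => Glued.pt d (d.F.symm m)) (d.F '' ball 0 d.r₂) := by
      refine k4.comp_contMDiffOn (k3.comp (k2.comp_contMDiffOn k1) fun m _ => ?_)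
      exact OnePoint.ne_infty_iff_exists.1 (hfinQ (d.F.symm m))
    exact key.congr fun m _ => rfl

end Main

/-! ### Surfaces: the unconditional statement -/

/-- **Smoothing a 2-disc relative to a shell (Hatcher 2013/2025, Handle Smoothing Theorem (2) /
Fact 6, static form), unconditionally.**  For an open topological embedding `F : ℝ² ⇀ M` of the
disc `‖z‖ < r₂` into a smooth surface which is a diffeomorphism onto its image on the shell
`r₁ < ‖z‖ < r₂`, and `r₁ < R ≤ r₂`, there is a homeomorphism `g` of `ℝ²`, the identity on
`‖z‖ ≥ R`, such that `F ∘ g` is a diffeomorphism of the disc `‖z‖ < r₂` onto `F (disc)` (smooth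
with smooth inverse).  From `exists_homeomorph_smoothing_rel_shell` and the tree's smooth Poincaré
theorem in dimension two `nonemptyDiffeomorphSphere_two_holds` (`Θ₂ = 0`).
[cite: Hatcher2025, Handle Smoothing Theorem (2) and Fact 6] -/
theorem exists_homeomorph_smoothing_disc_rel_shell_two {M : Type*} [TopologicalSpace M]
    [ChartedSpace (𝔼 2) M] [IsManifold (𝓡 2) ∞ M] (d : GlueData 2 M) {R : ℝ} (hR : d.r₁ < R)
    (hR₂ : R ≤ d.r₂) :
    ∃ g : 𝔼 2 ≃ₜ 𝔼 2, (∀ z, R ≤ ‖z‖ → g z = z) ∧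
      ContMDiffOn 𝓘(ℝ, 𝔼 2) (𝓡 2) ∞ (d.F ∘ g) (ball 0 d.r₂) ∧
      ContMDiffOn (𝓡 2) 𝓘(ℝ, 𝔼 2) ∞ (g.symm ∘ d.F.symm) (d.F '' ball 0 d.r₂) :=
  exists_homeomorph_smoothing_rel_shell two_ne_zero
    (fun X _ _ _ => nonemptyDiffeomorphSphere_two_holds X) d hR hR₂

end OnePointGluing

end Literature.Topology.FourManifolds
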